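import Literature.Probability.LatticeModels.PlanarIsingOnePointProofs
import Literature.Probability.LatticeModels.MeshDomainBulk
import Literature.Analysis.Complex.SimplyConnectedOfCompl
import Literature.Probability.LatticeModels.MeshInteriorHoleFree
import HarnessLib

/-!
# Polyomino domains are admissible and satisfy CHI's approximation hypothesis `MeshApproximates`

Topic: Probability / LatticeModels (geometry of the tree's discretisation scheme
`DomainDiscretisation.lean` / `PlanarIsing.lean` / `PlanarIsingOnePoint.lean`).

Chelkak–Hongler–Izyurov (*Conformal invariance of spin correlations in the planar Ising model*,
Ann. of Math. 181 (2015) = arXiv:1202.2838, §2.1 and §2.6) prove their theorems for families of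
simply connected discrete domains approximating a planar domain in the Hausdorff sense; for the
tree's FIXED discretisation scheme this is the hypothesis
`Literature.Probability.LatticeModels.MeshApproximates Ω` carried by every CHI fact of the tree
(`chi_onePoint_rho`, its three children in `PlanarIsingOnePointSplit.lean`, …). So far the tree
knew it only for the unit disc (`meshApproximates_ball`, by star-shapedness) and an axis-slit disc.
This file supplies a large class of domains satisfying it, enough to approximate any bounded domain
from inside and from outside: **polyomino domains**

`meshPolygon S a = interior (⋃ c ∈ S, meshCell a c)`,

the interior of a finite union of closed squares of side `a > 0` of the grid `aℤ²`, for a set of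
coarse sites `S` which is connected in `ℤ²` and whose complement is connected in `ℤ²`.

* `Polyomino.isAdmissibleDomain_meshPolygon` — such a domain is admissible (open, bounded, nonempty,
  simply connected). Simple connectivity is obtained WITHOUT any Jordan-curve argument, from
  Conway VIII.2.2 ((c) ⇒ (a)) as proved in the tree (`Complex.isSimplyConnected_of_isConnected_compl`:
  a bounded plane domain with connected complement is simply connected): the domain contains the
  "web" of the open cells and open double boxes of adjacent cells of `S` (connected when `S` is) and
  lies in its closure; its complement is the closure of the complement of the union of the closed
  cells, which contains the web of `Sᶜ` and lies in its closure.
* `Polyomino.meshApproximates_meshPolygon` — **such a domain satisfies `MeshApproximates`.** For a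
  fine mesh `δ` (`3δ < a`): no fine bond between sites of the domain leaves its closure
  (`segment_subset_closure_meshPolygon`: complementary gaps along lattice lines have length `≥ a`),
  the fine mesh graph of the domain is connected (monotone walks towards the centre fine site of the
  coarse cell, `induce_reachable_update`, and the tree's staircase lemma), so the discrete domain is
  all of the fine sites (`meshDomain_meshPolygon_eq`) and the free sites are exactly the fine sites
  whose four neighbours are in the domain (`mem_meshInteriorFinset_meshPolygon_iff`, the set
  `intSites`). These form a nonempty lattice-connected set with lattice-connected complement
  (`intSites_preconnected`, `intSites_compl_preconnected`: the sites off the domain are those of the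
  closed cells off `S`, `not_mem_meshPolygon_iff`), so the polygonal domain `P_δ` of the free sites
  is again an admissible (fine) polyomino domain, in particular simply connected
  (`isSimplyConnected_meshInteriorPolygon`); `hausdorffDist (∂P_δ) (∂Ω) ≤ 6δ`
  (`hausdorffDist_frontier_le`: a frontier point of either set is within `6δ` of a segment joining
  a point of the other open set to a point outside it); and compact subsets are swallowed
  (`eventually_subset_meshInteriorPolygon`).

Everything here is elementary lattice geometry ([folklore]); the CHI citation on the final theorem
records whose hypothesis is being verified. No named facts are introduced.

## References

* D. Chelkak, C. Hongler, K. Izyurov, Ann. of Math. (2) 181 (2015) 1087–1138 = arXiv:1202.2838,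
  §2.1 (discrete domains as unions of faces; simple connectivity of the polygonal domain) and §2.6
  (Hausdorff approximation). [ChelkakHonglerIzyurovAnnals2015]
* J. B. Conway, *Functions of One Complex Variable I* (1978), Thm. VIII.2.2. [Conway1978]
-/

noncomputable section

open Set Metric Filter Topology
open Literature.Probability.LatticeModels

namespace Literature.Probability.LatticeModels

namespace Polyomino

/-! ### Open boxes, open cells and the double boxes of two adjacent cells -/

/-- The open axis-parallel box `(x₁, x₂) × (y₁, y₂) ⊆ ℂ`. [folklore] -/
def openBox (x₁ x₂ y₁ y₂ : ℝ) : Set ℂ :=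
  {z | x₁ < z.re} ∩ {z | z.re < x₂} ∩ {z | y₁ < z.im} ∩ {z | z.im < y₂}

/-- Membership in an open box, unfolded. [folklore] -/
theorem mem_openBox {x₁ x₂ y₁ y₂ : ℝ} {z : ℂ} :
    z ∈ openBox x₁ x₂ y₁ y₂ ↔ x₁ < z.re ∧ z.re < x₂ ∧ y₁ < z.im ∧ z.im < y₂ := by
  simp [openBox, and_assoc]

/-- Open boxes are open. [folklore] -/
theorem isOpen_openBox (x₁ x₂ y₁ y₂ : ℝ) : IsOpen (openBox x₁ x₂ y₁ y₂) :=
  (((isOpen_lt continuous_const Complex.continuous_re).inter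
    (isOpen_lt Complex.continuous_re continuous_const)).inter
    (isOpen_lt continuous_const Complex.continuous_im)).inter
    (isOpen_lt Complex.continuous_im continuous_const)

/-- Open boxes are convex. [folklore] -/
theorem convex_openBox (x₁ x₂ y₁ y₂ : ℝ) : Convex ℝ (openBox x₁ x₂ y₁ y₂) :=
  (((convex_halfSpace_re_gt x₁).inter (convex_halfSpace_re_lt x₂)).inter
    (convex_halfSpace_im_gt y₁)).inter (convex_halfSpace_im_lt y₂)

/-- The open cell of side `s` centred at the mesh point `s·x`. [folklore] -/
def openCell (s : ℝ) (x : Site 2) : Set ℂ :=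
  openBox (s * x 0 - s / 2) (s * x 0 + s / 2) (s * x 1 - s / 2) (s * x 1 + s / 2)

/-- Membership in an open cell: both coordinates strictly within `s/2` of the centre. [folklore] -/
theorem mem_openCell_iff {s : ℝ} {x : Site 2} {z : ℂ} :
    z ∈ openCell s x ↔ |z.re - s * x 0| < s / 2 ∧ |z.im - s * x 1| < s / 2 := by
  rw [openCell, mem_openBox, abs_lt, abs_lt]
  constructor
  · rintro ⟨h1, h2, h3, h4⟩; exact ⟨⟨by linarith, by linarith⟩, by linarith, by linarith⟩
  · rintro ⟨⟨h1, h2⟩, h3, h4⟩; exact ⟨by linarith, by linarith, by linarith, by linarith⟩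

/-- Open cells are open. [folklore] -/
theorem isOpen_openCell (s : ℝ) (x : Site 2) : IsOpen (openCell s x) := isOpen_openBox _ _ _ _

/-- Open cells are convex. [folklore] -/
theorem convex_openCell (s : ℝ) (x : Site 2) : Convex ℝ (openCell s x) := convex_openBox _ _ _ _

/-- The open cell lies in the closed cell. [folklore] -/
theorem openCell_subset_meshCell (s : ℝ) (x : Site 2) : openCell s x ⊆ meshCell s x := fun z hz => by
  obtain ⟨h1, h2⟩ := mem_openCell_iff.1 hz
  exact mem_meshCell_iff.2 ⟨h1.le, h2.le⟩

/-- The mesh point of a site lies in its open cell (`s > 0`). [folklore] -/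
theorem meshPoint_mem_openCell {s : ℝ} (hs : 0 < s) (x : Site 2) : meshPoint s x ∈ openCell s x := by
  rw [mem_openCell_iff, meshPoint_re, meshPoint_im]
  constructor <;> simpa using half_pos hs

/-- The horizontal double box: the open `2 × 1` box covering the cells of `c` and `c + e₀`.
[folklore] -/
def hBox (s : ℝ) (c : Site 2) : Set ℂ :=
  openBox (s * c 0 - s / 2) (s * c 0 + 3 * s / 2) (s * c 1 - s / 2) (s * c 1 + s / 2)

/-- The vertical double box: the open `1 × 2` box covering the cells of `c` and `c + e₁`.
[folklore] -/
def vBox (s : ℝ) (c : Site 2) : Set ℂ :=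
  openBox (s * c 0 - s / 2) (s * c 0 + s / 2) (s * c 1 - s / 2) (s * c 1 + 3 * s / 2)

/-- Membership in the horizontal double box, unfolded. [folklore] -/
theorem mem_hBox {s : ℝ} {c : Site 2} {z : ℂ} : z ∈ hBox s c ↔
    s * c 0 - s / 2 < z.re ∧ z.re < s * c 0 + 3 * s / 2 ∧ s * c 1 - s / 2 < z.im ∧ z.im < s * c 1 + s / 2 :=
  mem_openBox

/-- Membership in the vertical double box, unfolded. [folklore] -/
theorem mem_vBox {s : ℝ} {c : Site 2} {z : ℂ} : z ∈ vBox s c ↔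
    s * c 0 - s / 2 < z.re ∧ z.re < s * c 0 + s / 2 ∧ s * c 1 - s / 2 < z.im ∧ z.im < s * c 1 + 3 * s / 2 :=
  mem_openBox

/-- Coordinates of a unit-vector translate of a site. [folklore] -/
@[simp] theorem add_single_zero_apply_zero (c : Site 2) : (c + Pi.single 0 1 : Site 2) 0 = c 0 + 1 := by simp
/-- Coordinates of a unit-vector translate of a site. [folklore] -/
@[simp] theorem add_single_zero_apply_one (c : Site 2) : (c + Pi.single 0 1 : Site 2) 1 = c 1 := by simp
/-- Coordinates of a unit-vector translate of a site. [folklore] -/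
@[simp] theorem add_single_one_apply_zero (c : Site 2) : (c + Pi.single 1 1 : Site 2) 0 = c 0 := by simp
/-- Coordinates of a unit-vector translate of a site. [folklore] -/
@[simp] theorem add_single_one_apply_one (c : Site 2) : (c + Pi.single 1 1 : Site 2) 1 = c 1 + 1 := by simp
/-- Coordinates of a unit-vector translate of a site. [folklore] -/
@[simp] theorem sub_single_zero_apply_zero (c : Site 2) : (c - Pi.single 0 1 : Site 2) 0 = c 0 - 1 := by simp
/-- Coordinates of a unit-vector translate of a site. [folklore] -/
@[simp] theorem sub_single_zero_apply_one (c : Site 2) : (c - Pi.single 0 1 : Site 2) 1 = c 1 := by simp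
/-- Coordinates of a unit-vector translate of a site. [folklore] -/
@[simp] theorem sub_single_one_apply_zero (c : Site 2) : (c - Pi.single 1 1 : Site 2) 0 = c 0 := by simp
/-- Coordinates of a unit-vector translate of a site. [folklore] -/
@[simp] theorem sub_single_one_apply_one (c : Site 2) : (c - Pi.single 1 1 : Site 2) 1 = c 1 - 1 := by simp

/-- The horizontal double box lies in the two closed cells it covers. [folklore] -/
theorem hBox_subset (s : ℝ) (c : Site 2) :
    hBox s c ⊆ meshCell s c ∪ meshCell s (c + Pi.single 0 1) := by
  intro z hz
  obtain ⟨h1, h2, h3, h4⟩ := mem_hBox.1 hz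
  by_cases h : z.re ≤ s * c 0 + s / 2
  · exact Or.inl (mem_meshCell_iff.2 ⟨abs_le.2 ⟨by linarith, by linarith⟩, abs_le.2 ⟨by linarith, by linarith⟩⟩)
  · refine Or.inr (mem_meshCell_iff.2 ⟨?_, ?_⟩)
    · rw [add_single_zero_apply_zero]; push_cast
      exact abs_le.2 ⟨by linarith, by linarith⟩
    · rw [add_single_zero_apply_one]
      exact abs_le.2 ⟨by linarith, by linarith⟩

/-- The vertical double box lies in the two closed cells it covers. [folklore] -/
theorem vBox_subset (s : ℝ) (c : Site 2) :
    vBox s c ⊆ meshCell s c ∪ meshCell s (c + Pi.single 1 1) := by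
  intro z hz
  obtain ⟨h1, h2, h3, h4⟩ := mem_vBox.1 hz
  by_cases h : z.im ≤ s * c 1 + s / 2
  · exact Or.inl (mem_meshCell_iff.2 ⟨abs_le.2 ⟨by linarith, by linarith⟩, abs_le.2 ⟨by linarith, by linarith⟩⟩)
  · refine Or.inr (mem_meshCell_iff.2 ⟨?_, ?_⟩)
    · rw [add_single_one_apply_zero]
      exact abs_le.2 ⟨by linarith, by linarith⟩
    · rw [add_single_one_apply_one]; push_cast
      exact abs_le.2 ⟨by linarith, by linarith⟩

/-- The open cell lies in the horizontal double box. [folklore] -/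
theorem openCell_subset_hBox (s : ℝ) (hs : 0 < s) (c : Site 2) : openCell s c ⊆ hBox s c := fun z hz => by
  obtain ⟨h1, h2⟩ := mem_openCell_iff.1 hz
  rw [abs_lt] at h1 h2
  exact mem_hBox.2 ⟨by linarith, by linarith, by linarith, by linarith⟩

/-- The open cell lies in the vertical double box. [folklore] -/
theorem openCell_subset_vBox (s : ℝ) (hs : 0 < s) (c : Site 2) : openCell s c ⊆ vBox s c := fun z hz => by
  obtain ⟨h1, h2⟩ := mem_openCell_iff.1 hz
  rw [abs_lt] at h1 h2
  exact mem_vBox.2 ⟨by linarith, by linarith, by linarith, by linarith⟩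

/-- The mesh point of `c` lies in its horizontal double box. [folklore] -/
theorem meshPoint_mem_hBox {s : ℝ} (hs : 0 < s) (c : Site 2) : meshPoint s c ∈ hBox s c :=
  openCell_subset_hBox s hs c (meshPoint_mem_openCell hs c)

/-- The mesh point of `c` lies in its vertical double box. [folklore] -/
theorem meshPoint_mem_vBox {s : ℝ} (hs : 0 < s) (c : Site 2) : meshPoint s c ∈ vBox s c :=
  openCell_subset_vBox s hs c (meshPoint_mem_openCell hs c)

/-- The mesh point of `c + e₀` lies in the horizontal double box of `c`. [folklore] -/
theorem meshPoint_add_mem_hBox {s : ℝ} (hs : 0 < s) (c : Site 2) :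
    meshPoint s (c + Pi.single 0 1) ∈ hBox s c := by
  rw [mem_hBox, meshPoint_re, meshPoint_im, add_single_zero_apply_zero, add_single_zero_apply_one]
  push_cast
  refine ⟨by linarith, by linarith, by linarith, by linarith⟩

/-- The mesh point of `c + e₁` lies in the vertical double box of `c`. [folklore] -/
theorem meshPoint_add_mem_vBox {s : ℝ} (hs : 0 < s) (c : Site 2) :
    meshPoint s (c + Pi.single 1 1) ∈ vBox s c := by
  rw [mem_vBox, meshPoint_re, meshPoint_im, add_single_one_apply_zero, add_single_one_apply_one]
  push_cast
  refine ⟨by linarith, by linarith, by linarith, by linarith⟩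

/-! ### Polyomino domains `meshPolygon Λ s`: the open cells and double boxes inside -/

variable {s : ℝ} {Λ : Set (Site 2)}

/-- A closed cell of a site of `Λ` lies in the union of the closed cells of `Λ`. [folklore] -/
theorem meshCell_subset_biUnion {c : Site 2} (hc : c ∈ Λ) : meshCell s c ⊆ ⋃ x ∈ Λ, meshCell s x :=
  subset_biUnion_of_mem (u := fun x => meshCell s x) hc

/-- The open cell of a site of `Λ` lies in the polyomino domain of `Λ`. [folklore] -/
theorem openCell_subset_meshPolygon {c : Site 2} (hc : c ∈ Λ) : openCell s c ⊆ meshPolygon Λ s :=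
  interior_maximal ((openCell_subset_meshCell s c).trans (meshCell_subset_biUnion hc)) (isOpen_openCell s c)

/-- The mesh point of a site of `Λ` lies in the polyomino domain of `Λ` (`s > 0`). [folklore] -/
theorem meshPoint_mem_meshPolygon (hs : 0 < s) {c : Site 2} (hc : c ∈ Λ) : meshPoint s c ∈ meshPolygon Λ s :=
  openCell_subset_meshPolygon hc (meshPoint_mem_openCell hs c)

/-- The horizontal double box of two sites of `Λ` lies in the polyomino domain. [folklore] -/
theorem hBox_subset_meshPolygon {c : Site 2} (hc : c ∈ Λ) (hc' : c + Pi.single 0 1 ∈ Λ) :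
    hBox s c ⊆ meshPolygon Λ s :=
  interior_maximal ((hBox_subset s c).trans
    (union_subset (meshCell_subset_biUnion hc) (meshCell_subset_biUnion hc'))) (isOpen_openBox _ _ _ _)

/-- The vertical double box of two sites of `Λ` lies in the polyomino domain. [folklore] -/
theorem vBox_subset_meshPolygon {c : Site 2} (hc : c ∈ Λ) (hc' : c + Pi.single 1 1 ∈ Λ) :
    vBox s c ⊆ meshPolygon Λ s :=
  interior_maximal ((vBox_subset s c).trans
    (union_subset (meshCell_subset_biUnion hc) (meshCell_subset_biUnion hc'))) (isOpen_openBox _ _ _ _)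

/-- **Row lemma.** If `p` lies in the polyomino domain and in the closed cell of `c`, then every
point on the horizontal line through `p` whose abscissa is strictly within `s/2` of that of the
centre of the cell lies in the polyomino domain (the open cell if `p` is not on a horizontal edge;
otherwise the open edge between the two cells through `p`, both of which belong to `Λ`).
[folklore] -/
theorem mem_meshPolygon_of_re (hs : 0 < s) {p q : ℂ} {c : Site 2} (hp : p ∈ meshPolygon Λ s)
    (hpc : p ∈ meshCell s c) (him : q.im = p.im) (hre : |q.re - s * c 0| < s / 2) :
    q ∈ meshPolygon Λ s := by
  have hc : c ∈ Λ := mem_of_mem_meshPolygon hs hp hpc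
  obtain ⟨hpre, hpim⟩ := mem_meshCell_iff.1 hpc
  rcases hpim.lt_or_eq with hlt | heq
  · exact openCell_subset_meshPolygon hc (mem_openCell_iff.2 ⟨hre, by rwa [him]⟩)
  · rw [abs_lt] at hre
    rcases (abs_eq (half_pos hs).le).1 heq with h | h
    · -- `p` on the top edge of the cell of `c`: the cell above also belongs to `Λ`
      have hc' : c + Pi.single 1 1 ∈ Λ := by
        refine mem_of_mem_meshPolygon hs hp (mem_meshCell_iff.2 ⟨?_, ?_⟩)
        · rwa [add_single_one_apply_zero]
        · rw [add_single_one_apply_one]; push_cast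
          rw [show p.im - s * (↑(c 1) + 1) = -(s / 2) by linarith, abs_neg, abs_of_pos (half_pos hs)]
      refine vBox_subset_meshPolygon hc hc' (mem_vBox.2 ⟨by linarith, by linarith, ?_, ?_⟩) <;> linarith
    · -- `p` on the bottom edge: the cell below belongs to `Λ`
      have hc' : c - Pi.single 1 1 ∈ Λ := by
        refine mem_of_mem_meshPolygon hs hp (mem_meshCell_iff.2 ⟨?_, ?_⟩)
        · rwa [sub_single_one_apply_zero]
        · rw [sub_single_one_apply_one]; push_cast
          rw [show p.im - s * (↑(c 1) - 1) = s / 2 by linarith, abs_of_pos (half_pos hs)]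
      have hcc : c - Pi.single 1 1 + Pi.single 1 1 = c := sub_add_cancel c _
      refine vBox_subset_meshPolygon hc' (hcc.symm ▸ hc) (mem_vBox.2 ⟨?_, ?_, ?_, ?_⟩)
      · rw [sub_single_one_apply_zero]; linarith
      · rw [sub_single_one_apply_zero]; linarith
      · rw [sub_single_one_apply_one]; push_cast; linarith
      · rw [sub_single_one_apply_one]; push_cast; linarith

/-- **Column lemma** (the row lemma with the coordinates exchanged). [folklore] -/
theorem mem_meshPolygon_of_im (hs : 0 < s) {p q : ℂ} {c : Site 2} (hp : p ∈ meshPolygon Λ s)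
    (hpc : p ∈ meshCell s c) (hre : q.re = p.re) (him : |q.im - s * c 1| < s / 2) :
    q ∈ meshPolygon Λ s := by
  have hc : c ∈ Λ := mem_of_mem_meshPolygon hs hp hpc
  obtain ⟨hpre, hpim⟩ := mem_meshCell_iff.1 hpc
  rcases hpre.lt_or_eq with hlt | heq
  · exact openCell_subset_meshPolygon hc (mem_openCell_iff.2 ⟨by rwa [hre], him⟩)
  · rw [abs_lt] at him
    rcases (abs_eq (half_pos hs).le).1 heq with h | h
    · have hc' : c + Pi.single 0 1 ∈ Λ := by
        refine mem_of_mem_meshPolygon hs hp (mem_meshCell_iff.2 ⟨?_, ?_⟩)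
        · rw [add_single_zero_apply_zero]; push_cast
          rw [show p.re - s * (↑(c 0) + 1) = -(s / 2) by linarith, abs_neg, abs_of_pos (half_pos hs)]
        · rwa [add_single_zero_apply_one]
      refine hBox_subset_meshPolygon hc hc' (mem_hBox.2 ⟨?_, ?_, by linarith, by linarith⟩) <;> linarith
    · have hc' : c - Pi.single 0 1 ∈ Λ := by
        refine mem_of_mem_meshPolygon hs hp (mem_meshCell_iff.2 ⟨?_, ?_⟩)
        · rw [sub_single_zero_apply_zero]; push_cast
          rw [show p.re - s * (↑(c 0) - 1) = s / 2 by linarith, abs_of_pos (half_pos hs)]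
        · rwa [sub_single_zero_apply_one]
      have hcc : c - Pi.single 0 1 + Pi.single 0 1 = c := sub_add_cancel c _
      refine hBox_subset_meshPolygon hc' (hcc.symm ▸ hc) (mem_hBox.2 ⟨?_, ?_, ?_, ?_⟩)
      · rw [sub_single_zero_apply_zero]; push_cast; linarith
      · rw [sub_single_zero_apply_zero]; push_cast; linarith
      · rw [sub_single_zero_apply_one]; linarith
      · rw [sub_single_zero_apply_one]; linarith

/-! ### The two double boxes as a family indexed by the direction -/

/-- The double box of `c` in direction `i`: `hBox` for `i = 0`, `vBox` for `i = 1`. [folklore] -/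
def box (s : ℝ) (c : Site 2) : Fin 2 → Set ℂ := ![hBox s c, vBox s c]

/-- `box s c 0` is the horizontal double box. [folklore] -/
@[simp] theorem box_zero (s : ℝ) (c : Site 2) : box s c 0 = hBox s c := rfl
/-- `box s c 1` is the vertical double box. [folklore] -/
@[simp] theorem box_one (s : ℝ) (c : Site 2) : box s c 1 = vBox s c := rfl

/-- A double box lies in the two closed cells it covers. [folklore] -/
theorem box_subset (s : ℝ) (c : Site 2) (i : Fin 2) :
    box s c i ⊆ meshCell s c ∪ meshCell s (c + Pi.single i 1) := by
  fin_cases i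
  · exact hBox_subset s c
  · exact vBox_subset s c

/-- Double boxes are open. [folklore] -/
theorem isOpen_box (s : ℝ) (c : Site 2) (i : Fin 2) : IsOpen (box s c i) := by
  fin_cases i <;> exact isOpen_openBox _ _ _ _

/-- Double boxes are convex. [folklore] -/
theorem convex_box (s : ℝ) (c : Site 2) (i : Fin 2) : Convex ℝ (box s c i) := by
  fin_cases i <;> exact convex_openBox _ _ _ _

/-- The mesh point of `c` lies in its double boxes. [folklore] -/
theorem meshPoint_mem_box {s : ℝ} (hs : 0 < s) (c : Site 2) (i : Fin 2) : meshPoint s c ∈ box s c i := by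
  fin_cases i
  · exact meshPoint_mem_hBox hs c
  · exact meshPoint_mem_vBox hs c

/-- The mesh point of `c + eᵢ` lies in the double box of `c` in direction `i`. [folklore] -/
theorem meshPoint_add_mem_box {s : ℝ} (hs : 0 < s) (c : Site 2) (i : Fin 2) :
    meshPoint s (c + Pi.single i 1) ∈ box s c i := by
  fin_cases i
  · exact meshPoint_add_mem_hBox hs c
  · exact meshPoint_add_mem_vBox hs c

/-- The double box of two sites of `Λ` lies in the polyomino domain. [folklore] -/
theorem box_subset_meshPolygon {s : ℝ} {Λ : Set (Site 2)} {c : Site 2} {i : Fin 2} (hc : c ∈ Λ)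
    (hc' : c + Pi.single i 1 ∈ Λ) : box s c i ⊆ meshPolygon Λ s := by
  fin_cases i
  · exact hBox_subset_meshPolygon hc hc'
  · exact vBox_subset_meshPolygon hc hc'

/-- A point of an open cell lies in no other closed cell. [folklore] -/
theorem eq_of_mem_openCell_of_mem_meshCell {s : ℝ} (hs : 0 < s) {c d : Site 2} {z : ℂ}
    (hd : z ∈ openCell s d) (hc : z ∈ meshCell s c) : c = d := by
  obtain ⟨hd0, hd1⟩ := mem_openCell_iff.1 hd
  obtain ⟨hc0, hc1⟩ := mem_meshCell_iff.1 hc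
  rw [abs_lt] at hd0 hd1
  rw [abs_le] at hc0 hc1
  have key : ∀ (m n : ℤ) (t : ℝ), -(s / 2) < t - s * n → t - s * n < s / 2 → -(s / 2) ≤ t - s * m →
      t - s * m ≤ s / 2 → m = n := by
    intro m n t h1 h2 h3 h4
    have h5' : (m : ℝ) - n - 1 < 0 := by
      by_contra h; push Not at h; nlinarith
    have h6' : 0 < (m : ℝ) - n + 1 := by
      by_contra h; push Not at h; nlinarith
    have h7 : m - n - 1 < 0 := by exact_mod_cast h5'
    have h8 : 0 < m - n + 1 := by exact_mod_cast h6'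
    omega
  have h0 := key (c 0) (d 0) z.re hd0.1 hd0.2 hc0.1 hc0.2
  have h1 := key (c 1) (d 1) z.im hd1.1 hd1.2 hc1.1 hc1.2
  funext j; fin_cases j
  · exact h0
  · exact h1

/-- A point of a double box lies only in the two closed cells it covers. [folklore] -/
theorem eq_or_eq_of_mem_box_of_mem_meshCell {s : ℝ} (hs : 0 < s) {c d : Site 2} {i : Fin 2} {z : ℂ}
    (hd : z ∈ box s d i) (hc : z ∈ meshCell s c) : c = d ∨ c = d + Pi.single i 1 := by
  obtain ⟨hc0, hc1⟩ := mem_meshCell_iff.1 hc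
  rw [abs_le] at hc0 hc1
  -- the coordinate across the box is pinned, the one along it takes one of two values
  have pin : ∀ (m n : ℤ) (t : ℝ), s * n - s / 2 < t → t < s * n + s / 2 → -(s / 2) ≤ t - s * m →
      t - s * m ≤ s / 2 → m = n := by
    intro m n t h1 h2 h3 h4
    have h5' : (m : ℝ) - n - 1 < 0 := by
      by_contra h; push Not at h; nlinarith
    have h6' : 0 < (m : ℝ) - n + 1 := by
      by_contra h; push Not at h; nlinarith
    have h7 : m - n - 1 < 0 := by exact_mod_cast h5'
    have h8 : 0 < m - n + 1 := by exact_mod_cast h6'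
    omega
  have two : ∀ (m n : ℤ) (t : ℝ), s * n - s / 2 < t → t < s * n + 3 * s / 2 → -(s / 2) ≤ t - s * m →
      t - s * m ≤ s / 2 → m = n ∨ m = n + 1 := by
    intro m n t h1 h2 h3 h4
    have h5' : (m : ℝ) - n - 2 < 0 := by
      by_contra h; push Not at h; nlinarith
    have h6' : 0 < (m : ℝ) - n + 1 := by
      by_contra h; push Not at h; nlinarith
    have h7 : m - n - 2 < 0 := by exact_mod_cast h5'
    have h8 : 0 < m - n + 1 := by exact_mod_cast h6'
    omega
  fin_cases i
  · obtain ⟨h1, h2, h3, h4⟩ := mem_hBox.1 (show z ∈ hBox s d from hd)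
    have e1 := pin (c 1) (d 1) z.im h3 h4 hc1.1 hc1.2
    rcases two (c 0) (d 0) z.re h1 h2 hc0.1 hc0.2 with e0 | e0
    · left; funext j; fin_cases j
      · exact e0
      · exact e1
    · right; funext j; fin_cases j
      · simpa using e0
      · simpa using e1
  · obtain ⟨h1, h2, h3, h4⟩ := mem_vBox.1 (show z ∈ vBox s d from hd)
    have e0 := pin (c 0) (d 0) z.re h1 h2 hc0.1 hc0.2
    rcases two (c 1) (d 1) z.im h3 h4 hc1.1 hc1.2 with e1 | e1
    · left; funext j; fin_cases j
      · exact e0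
      · exact e1
    · right; funext j; fin_cases j
      · simpa using e0
      · simpa using e1

/-- A closed cell lies in the closure of its open cell (`s > 0`): shrink towards the centre.
[folklore] -/
theorem meshCell_subset_closure_openCell {s : ℝ} (hs : 0 < s) (c : Site 2) :
    meshCell s c ⊆ closure (openCell s c) := by
  intro p hp
  obtain ⟨hre, him⟩ := mem_meshCell_iff.1 hp
  set f : ℝ → ℂ := fun t => meshPoint s c + ((1 - t : ℝ) : ℂ) * (p - meshPoint s c) with hf
  have hcont : Continuous f := by
    simp only [hf]
    fun_prop
  have h0 : f 0 = p := by simp [hf]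
  have htend : Tendsto f (𝓝[>] 0) (𝓝 p) :=
    tendsto_nhdsWithin_of_tendsto_nhds (h0 ▸ hcont.tendsto 0)
  refine mem_closure_of_tendsto htend ?_
  filter_upwards [Ioo_mem_nhdsGT one_pos] with t ht
  have hre' : (f t).re - s * c 0 = (1 - t) * (p.re - s * c 0) := by
    simp only [hf, Complex.add_re, meshPoint_re, Complex.re_ofReal_mul, Complex.sub_re]; ring
  have him' : (f t).im - s * c 1 = (1 - t) * (p.im - s * c 1) := by
    simp only [hf, Complex.add_im, meshPoint_im, Complex.im_ofReal_mul, Complex.sub_im]; ring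
  have h1t : 0 < 1 - t := by linarith [ht.2]
  have h1t' : 1 - t < 1 := by linarith [ht.1]
  refine mem_openCell_iff.2 ⟨?_, ?_⟩
  · rw [hre', abs_mul, abs_of_pos h1t]
    calc (1 - t) * |p.re - s * c 0| ≤ (1 - t) * (s / 2) := by gcongr
      _ < 1 * (s / 2) := by gcongr
      _ = s / 2 := one_mul _
  · rw [him', abs_mul, abs_of_pos h1t]
    calc (1 - t) * |p.im - s * c 1| ≤ (1 - t) * (s / 2) := by gcongr
      _ < 1 * (s / 2) := by gcongr
      _ = s / 2 := one_mul _

/-! ### The web of a set of sites: a connected open skeleton of its polyomino domain -/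

/-- The web of the site `c` relative to `Λ`: its open cell together with the double boxes
towards those of its four lattice neighbours that belong to `Λ`, as a family of sets.
[folklore] -/
def webFamily (Λ : Set (Site 2)) (s : ℝ) (c : Site 2) : Set (Set ℂ) :=
  {openCell s c} ∪ {B | ∃ i : Fin 2, c + Pi.single i 1 ∈ Λ ∧ B = box s c i} ∪
    {B | ∃ i : Fin 2, c - Pi.single i 1 ∈ Λ ∧ B = box s (c - Pi.single i 1) i}

/-- The web of the site `c` relative to `Λ` (the union of `webFamily`). [folklore] -/
def web (Λ : Set (Site 2)) (s : ℝ) (c : Site 2) : Set ℂ := ⋃₀ webFamily Λ s c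

/-- The open cell of `c` belongs to its web. [folklore] -/
theorem openCell_subset_web (Λ : Set (Site 2)) (s : ℝ) (c : Site 2) : openCell s c ⊆ web Λ s c :=
  subset_sUnion_of_mem (Or.inl (Or.inl rfl))

/-- The double box towards a neighbour in `Λ` belongs to the web. [folklore] -/
theorem box_subset_web {Λ : Set (Site 2)} {s : ℝ} {c : Site 2} {i : Fin 2} (h : c + Pi.single i 1 ∈ Λ) :
    box s c i ⊆ web Λ s c :=
  subset_sUnion_of_mem (Or.inl (Or.inr ⟨i, h, rfl⟩))

/-- The double box from the neighbour `c - eᵢ ∈ Λ` belongs to the web of `c`. [folklore] -/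
theorem box_sub_subset_web {Λ : Set (Site 2)} {s : ℝ} {c : Site 2} {i : Fin 2} (h : c - Pi.single i 1 ∈ Λ) :
    box s (c - Pi.single i 1) i ⊆ web Λ s c :=
  subset_sUnion_of_mem (Or.inr ⟨i, h, rfl⟩)

/-- The mesh point of `c` lies in its web (`s > 0`). [folklore] -/
theorem meshPoint_mem_web {Λ : Set (Site 2)} {s : ℝ} (hs : 0 < s) (c : Site 2) : meshPoint s c ∈ web Λ s c :=
  openCell_subset_web Λ s c (meshPoint_mem_openCell hs c)

/-- The web of a site is preconnected: all its pieces are convex and contain the centre. [folklore] -/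
theorem isPreconnected_web {Λ : Set (Site 2)} {s : ℝ} (hs : 0 < s) (c : Site 2) : IsPreconnected (web Λ s c) := by
  refine isPreconnected_sUnion (meshPoint s c) _ ?_ ?_
  · rintro B ((rfl | ⟨i, -, rfl⟩) | ⟨i, -, rfl⟩)
    · exact meshPoint_mem_openCell hs c
    · exact meshPoint_mem_box hs c i
    · have := meshPoint_add_mem_box hs (c - Pi.single i 1) i
      rwa [sub_add_cancel] at this
  · rintro B ((rfl | ⟨i, -, rfl⟩) | ⟨i, -, rfl⟩)
    · exact (convex_openCell s c).isPreconnected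
    · exact (convex_box s c i).isPreconnected
    · exact (convex_box s _ i).isPreconnected

/-- The web of a site of `Λ` lies in the polyomino domain of `Λ`. [folklore] -/
theorem web_subset_meshPolygon {Λ : Set (Site 2)} {s : ℝ} {c : Site 2} (hc : c ∈ Λ) : web Λ s c ⊆ meshPolygon Λ s := by
  refine sUnion_subset ?_
  rintro B ((rfl | ⟨i, hi, rfl⟩) | ⟨i, hi, rfl⟩)
  · exact openCell_subset_meshPolygon hc
  · exact box_subset_meshPolygon hc hi
  · exact box_subset_meshPolygon hi (by rwa [sub_add_cancel])

/-- Webs of adjacent sites meet. [folklore] -/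
theorem web_inter_web_nonempty {Λ : Set (Site 2)} {s : ℝ} (hs : 0 < s) {c d : Site 2} (hc : c ∈ Λ) (hd : d ∈ Λ)
    (h : (zdGraph 2).Adj c d) : (web Λ s c ∩ web Λ s d).Nonempty := by
  obtain ⟨i, rfl | rfl⟩ := (zdGraph_adj_iff c d).1 h
  · refine ⟨meshPoint s c, box_subset_web hd (meshPoint_mem_box hs c i), ?_⟩
    have h' : c + Pi.single i 1 - Pi.single i 1 ∈ Λ := by rwa [add_sub_cancel_right]
    have := box_sub_subset_web (s := s) h'
    rw [add_sub_cancel_right] at this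
    exact this (meshPoint_mem_box hs c i)
  · refine ⟨meshPoint s d, ?_, box_subset_web hc (meshPoint_mem_box hs d i)⟩
    have h' : d + Pi.single i 1 - Pi.single i 1 ∈ Λ := by rwa [add_sub_cancel_right]
    have := box_sub_subset_web (s := s) h'
    rw [add_sub_cancel_right] at this
    exact this (meshPoint_mem_box hs d i)

/-- **The total web of a lattice-connected set of sites is preconnected.** [folklore] -/
theorem isPreconnected_biUnion_web {Λ : Set (Site 2)} {s : ℝ} (hs : 0 < s)
    (hΛ : ((zdGraph 2).induce Λ).Preconnected) : IsPreconnected (⋃ c ∈ Λ, web Λ s c) := by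
  refine IsPreconnected.biUnion_of_reflTransGen (fun c _ => isPreconnected_web hs c) ?_
  intro c hc d hd
  have hr := (SimpleGraph.reachable_iff_reflTransGen _ _).1 (hΛ ⟨c, hc⟩ ⟨d, hd⟩)
  exact Relation.ReflTransGen.lift (r := ((zdGraph 2).induce Λ).Adj)
    (p := fun i j : Site 2 => (web Λ s i ∩ web Λ s j).Nonempty ∧ i ∈ Λ) (fun x => (x : Site 2))
    (fun x y hxy => ⟨web_inter_web_nonempty hs x.2 y.2 (SimpleGraph.comap_adj.1 hxy), x.2⟩) _ _ hr

/-! ### Connectivity of a polyomino domain and of its complement -/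

/-- **A polyomino domain on a lattice-connected set of sites is preconnected**: it contains the
total web (open cells and double boxes) and lies in its closure. [folklore] -/
theorem isPreconnected_meshPolygon {Λ : Set (Site 2)} {s : ℝ} (hs : 0 < s)
    (hΛ : ((zdGraph 2).induce Λ).Preconnected) : IsPreconnected (meshPolygon Λ s) := by
  refine (isPreconnected_biUnion_web hs hΛ).subset_closure
    (iUnion₂_subset fun c hc => web_subset_meshPolygon hc) fun p hp => ?_
  have hpc := mem_meshCell_nearestSite hs p
  have hc : nearestSite s p ∈ Λ := mem_of_mem_meshPolygon hs hp hpc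
  exact closure_mono ((openCell_subset_web Λ s _).trans (subset_biUnion_of_mem (u := fun c => web Λ s c) hc))
    (meshCell_subset_closure_openCell hs _ hpc)

/-- The web of a site off `Λ` relative to `Λᶜ` misses every closed cell of `Λ`. [folklore] -/
theorem web_compl_subset_compl {Λ : Set (Site 2)} {s : ℝ} (hs : 0 < s) {d : Site 2} (hd : d ∉ Λ) :
    web Λᶜ s d ⊆ (⋃ c ∈ Λ, meshCell s c)ᶜ := by
  intro z hz hzA
  simp only [mem_iUnion, exists_prop] at hzA
  obtain ⟨c, hc, hzc⟩ := hzA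
  obtain ⟨B, ((rfl | ⟨i, hi, rfl⟩) | ⟨i, hi, rfl⟩), hzB⟩ := hz
  · exact hd ((eq_of_mem_openCell_of_mem_meshCell hs hzB hzc) ▸ hc)
  · rcases eq_or_eq_of_mem_box_of_mem_meshCell hs hzB hzc with rfl | rfl
    · exact hd hc
    · exact hi hc
  · rcases eq_or_eq_of_mem_box_of_mem_meshCell hs hzB hzc with rfl | h
    · exact hi hc
    · rw [sub_add_cancel] at h
      exact hd (h ▸ hc)

/-- **The complement of the union of the closed cells of `Λ` is preconnected when `Λᶜ` is lattice
connected**: it contains the total web of `Λᶜ` and lies in its closure. [folklore] -/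
theorem isPreconnected_compl_biUnion_meshCell {Λ : Set (Site 2)} {s : ℝ} (hs : 0 < s)
    (hΛc : ((zdGraph 2).induce Λᶜ).Preconnected) : IsPreconnected (⋃ c ∈ Λ, meshCell s c)ᶜ := by
  refine (isPreconnected_biUnion_web hs hΛc).subset_closure
    (iUnion₂_subset fun d hd => web_compl_subset_compl hs hd) fun z hz => ?_
  have hzd := mem_meshCell_nearestSite hs z
  have hd : nearestSite s z ∈ Λᶜ := fun h => hz (mem_iUnion₂.2 ⟨_, h, hzd⟩)
  exact closure_mono ((openCell_subset_web Λᶜ s _).trans (subset_biUnion_of_mem (u := fun c => web Λᶜ s c) hd))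
    (meshCell_subset_closure_openCell hs _ hzd)

/-- **The complement of a polyomino domain is preconnected when `Λᶜ` is lattice connected** (it is
the closure of the complement of the union of the closed cells). [folklore] -/
theorem isPreconnected_compl_meshPolygon {Λ : Set (Site 2)} {s : ℝ} (hs : 0 < s)
    (hΛc : ((zdGraph 2).induce Λᶜ).Preconnected) : IsPreconnected (meshPolygon Λ s)ᶜ := by
  rw [meshPolygon, ← closure_compl]
  exact (isPreconnected_compl_biUnion_meshCell hs hΛc).closure

/-- A closed cell lies in the closed ball of radius `s` about its centre (`‖w‖ ≤ |re w| + |im w|`).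
[folklore] -/
theorem meshCell_subset_closedBall {s : ℝ} (c : Site 2) : meshCell s c ⊆ closedBall (meshPoint s c) s := by
  intro z hz
  obtain ⟨h0, h1⟩ := mem_meshCell_iff.1 hz
  rw [mem_closedBall, Complex.dist_eq]
  refine (Complex.norm_le_abs_re_add_abs_im _).trans ?_
  rw [Complex.sub_re, Complex.sub_im, meshPoint_re, meshPoint_im]
  linarith [abs_nonneg (z.re - s * c 0)]

/-- The union of the closed cells of a finite set of sites is bounded. [folklore] -/
theorem isBounded_biUnion_meshCell {Λ : Set (Site 2)} (hΛ : Λ.Finite) (s : ℝ) :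
    Bornology.IsBounded (⋃ c ∈ Λ, meshCell s c) :=
  (Bornology.isBounded_biUnion hΛ).2 fun c _ => isBounded_closedBall.subset (meshCell_subset_closedBall c)

/-- **Polyomino domains are admissible.** For `s > 0` and a finite nonempty set of sites `Λ`
which is connected in `ℤ²` and whose complement is connected in `ℤ²`, the polyomino domain
`meshPolygon Λ s` (the interior of the union of the closed cells of `Λ`) is open, bounded,
nonempty and simply connected — the last by Conway VIII.2.2 ((c) ⇒ (a)): a bounded plane domain
with connected complement is simply connected (`Complex.isSimplyConnected_of_isConnected_compl`).
[cite: Conway1978, Ch. VIII Thm. 2.2 ((c)⇒(a))] -/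
theorem isAdmissibleDomain_meshPolygon {Λ : Set (Site 2)} {s : ℝ} (hs : 0 < s) (hfin : Λ.Finite)
    (hne : Λ.Nonempty) (hΛ : ((zdGraph 2).induce Λ).Preconnected)
    (hΛc : ((zdGraph 2).induce Λᶜ).Preconnected) : IsAdmissibleDomain (meshPolygon Λ s) := by
  obtain ⟨c, hc⟩ := hne
  have hne' : (meshPolygon Λ s).Nonempty := ⟨_, meshPoint_mem_meshPolygon hs hc⟩
  have hbdd : Bornology.IsBounded (meshPolygon Λ s) := (isBounded_biUnion_meshCell hfin s).subset interior_subset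
  exact ⟨isOpen_meshPolygon Λ s, hbdd, hne', Complex.isSimplyConnected_of_isConnected_compl (isOpen_meshPolygon Λ s)
    ⟨hne', isPreconnected_meshPolygon hs hΛ⟩ hbdd (isPreconnected_compl_meshPolygon hs hΛc)⟩

/-! ### Closed cells off `Λ`; closure and complement of a polyomino domain -/

/-- The closed cells form a locally finite family (`s > 0`). [folklore] -/
theorem locallyFinite_meshCell {s : ℝ} (hs : 0 < s) : LocallyFinite fun d : Site 2 => meshCell s d := by
  intro z
  refine ⟨ball z s, ball_mem_nhds z hs, ?_⟩
  refine (meshVertices_finite (isBounded_closedBall (x := z) (r := 2 * s)) hs).subset ?_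
  rintro d ⟨w, hw, hwz⟩
  rw [mem_meshVertices_iff, mem_closedBall]
  have h1 : dist w (meshPoint s d) ≤ s := meshCell_subset_closedBall d hw
  have h2 : dist w z < s := hwz
  calc dist (meshPoint s d) z ≤ dist (meshPoint s d) w + dist w z := dist_triangle _ _ _
    _ ≤ s + s := add_le_add (by rwa [dist_comm]) h2.le
    _ = 2 * s := by ring

/-- Any union of closed cells is closed (`s > 0`; the family is locally finite). [folklore] -/
theorem isClosed_biUnion_meshCell {s : ℝ} (hs : 0 < s) (T : Set (Site 2)) : IsClosed (⋃ d ∈ T, meshCell s d) := by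
  rw [biUnion_eq_iUnion]
  exact ((locallyFinite_meshCell hs).comp_injective Subtype.val_injective).isClosed_iUnion
    fun d => isClosed_meshCell s d

/-- **A closed cell off `Λ` misses the polyomino domain of `Λ`.** [folklore] -/
theorem meshCell_disjoint_meshPolygon {s : ℝ} (hs : 0 < s) {Λ : Set (Site 2)} {d : Site 2} (hd : d ∉ Λ) :
    Disjoint (meshCell s d) (meshPolygon Λ s) := by
  rw [disjoint_left]
  intro z hz hzP
  have hzc : z ∈ closure (openCell s d) := meshCell_subset_closure_openCell hs d hz
  obtain ⟨w, hwP, hw⟩ := mem_closure_iff_nhds.1 hzc _ ((isOpen_meshPolygon Λ s).mem_nhds hzP)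
  have hwA : w ∈ ⋃ c ∈ Λ, meshCell s c := interior_subset hwP
  simp only [mem_iUnion, exists_prop] at hwA
  obtain ⟨c, hc, hwc⟩ := hwA
  exact hd ((eq_of_mem_openCell_of_mem_meshCell hs hw hwc) ▸ hc)

/-- **Points off the polyomino domain are the points of the closed cells off `Λ`** (`s > 0`).
[folklore] -/
theorem not_mem_meshPolygon_iff {s : ℝ} (hs : 0 < s) {Λ : Set (Site 2)} {p : ℂ} :
    p ∉ meshPolygon Λ s ↔ ∃ d ∉ Λ, p ∈ meshCell s d := by
  constructor
  · intro hp
    by_cases hA : p ∈ ⋃ c ∈ Λ, meshCell s c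
    · -- `p` is a frontier point of the union of the `Λ`-cells: it is in the closure of the
      -- complement, which lies in the (closed) union of the other cells
      have hfr : p ∈ closure (⋃ c ∈ Λ, meshCell s c)ᶜ := by
        rw [closure_compl]; exact hp
      have hsub : (⋃ c ∈ Λ, meshCell s c)ᶜ ⊆ ⋃ d ∈ Λᶜ, meshCell s d := by
        intro z hz
        have hzd := mem_meshCell_nearestSite hs z
        exact mem_iUnion₂.2 ⟨_, fun h => hz (mem_iUnion₂.2 ⟨_, h, hzd⟩), hzd⟩
      have := (isClosed_biUnion_meshCell hs Λᶜ).closure_subset_iff.2 hsub hfr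
      obtain ⟨d, hd, hpd⟩ : ∃ d ∈ Λᶜ, p ∈ meshCell s d := by simpa only [mem_iUnion, exists_prop] using this
      exact ⟨d, hd, hpd⟩
    · exact ⟨nearestSite s p, fun h => hA (mem_iUnion₂.2 ⟨_, h, mem_meshCell_nearestSite hs p⟩),
        mem_meshCell_nearestSite hs p⟩
  · rintro ⟨d, hd, hpd⟩ hp
    exact (meshCell_disjoint_meshPolygon hs hd).le_bot ⟨hpd, hp⟩

/-- Contrapositive form: a point all of whose closed cells belong to `Λ` lies in the polyomino
domain. [folklore] -/
theorem mem_meshPolygon_of_forall {s : ℝ} (hs : 0 < s) {Λ : Set (Site 2)} {p : ℂ}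
    (h : ∀ d, p ∈ meshCell s d → d ∈ Λ) : p ∈ meshPolygon Λ s := by
  by_contra hp
  obtain ⟨d, hd, hpd⟩ := (not_mem_meshPolygon_iff hs).1 hp
  exact hd (h d hpd)

/-- The mesh point of a site off `Λ` is off the polyomino domain. [folklore] -/
theorem meshPoint_not_mem_meshPolygon {s : ℝ} (hs : 0 < s) {Λ : Set (Site 2)} {d : Site 2} (hd : d ∉ Λ) :
    meshPoint s d ∉ meshPolygon Λ s :=
  (not_mem_meshPolygon_iff hs).2 ⟨d, hd, meshPoint_mem_meshCell hs.le d⟩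

/-- **The closure of a polyomino domain is the union of its closed cells** (`s > 0`). [folklore] -/
theorem closure_meshPolygon {s : ℝ} (hs : 0 < s) (Λ : Set (Site 2)) :
    closure (meshPolygon Λ s) = ⋃ c ∈ Λ, meshCell s c := by
  refine Subset.antisymm ((isClosed_biUnion_meshCell hs Λ).closure_subset_iff.2 interior_subset) ?_
  refine iUnion₂_subset fun c hc => (meshCell_subset_closure_openCell hs c).trans ?_
  exact closure_mono (openCell_subset_meshPolygon hc)

/-- The frontier of a polyomino domain lies in the closed cells off `Λ`. [folklore] -/
theorem exists_of_mem_frontier_meshPolygon {s : ℝ} (hs : 0 < s) {Λ : Set (Site 2)} {p : ℂ}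
    (hp : p ∈ frontier (meshPolygon Λ s)) : ∃ d ∉ Λ, p ∈ meshCell s d :=
  (not_mem_meshPolygon_iff hs).1 fun h => ((isOpen_meshPolygon Λ s).interior_eq ▸ hp.2) h

/-- A preconnected set meeting an open set and its complement meets its frontier. [folklore] -/
theorem exists_mem_frontier_of_isPreconnected {T U : Set ℂ} (hT : IsPreconnected T) (hU : IsOpen U)
    {v w : ℂ} (hv : v ∈ T) (hvU : v ∈ U) (hw : w ∈ T) (hwU : w ∉ U) : ∃ f ∈ T, f ∈ frontier U := by
  by_contra h
  push Not at h
  have hsub : closure U ∩ T ⊆ U := by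
    rintro f ⟨hfc, hfT⟩
    by_contra hfU
    exact h f hfT ⟨hfc, by rwa [hU.interior_eq]⟩
  exact hwU (hT.subset_of_closure_inter_subset hU ⟨v, hv, hvU⟩ hsub hw)

/-- On the segment from a point of an open set to a point outside it there is a frontier point.
[folklore] -/
theorem exists_mem_segment_mem_frontier {U : Set ℂ} (hU : IsOpen U) {v w : ℂ} (hv : v ∈ U) (hw : w ∉ U) :
    ∃ f ∈ segment ℝ v w, f ∈ frontier U :=
  exists_mem_frontier_of_isPreconnected (convex_segment v w).isPreconnected hU
    (left_mem_segment ℝ v w) hv (right_mem_segment ℝ v w) hw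

/-! ### A coarse polyomino seen by a fine lattice: sites, bonds, interior sites -/

section Fine

variable {a δ : ℝ} {S : Set (Site 2)}

/-- **No bond of the fine lattice leaves the closure** (fine mesh `δ < a`): the closed segment
between two `ℤ²`-adjacent fine sites of the polyomino domain lies in its closure — a
complementary gap of a polyomino along a lattice line has length `≥ a > δ`. [folklore] -/
theorem segment_subset_closure_meshPolygon (ha : 0 < a) (hδ : 0 < δ) (hδa : δ < a) {x y : Site 2}
    (hxy : (zdGraph 2).Adj x y) (hx : meshPoint δ x ∈ meshPolygon S a) (hy : meshPoint δ y ∈ meshPolygon S a) :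
    segment ℝ (meshPoint δ x) (meshPoint δ y) ⊆ closure (meshPolygon S a) := by
  -- one-dimensional heart: no gap of length `< a` between two points off a cell containing a
  -- point between them
  have gap : ∀ (u t : ℝ) (m : ℤ), 0 ≤ t → t ≤ δ → |u + t - a * m| ≤ a / 2 → a / 2 < |u - a * m| →
      a / 2 < |u + δ - a * m| → False := by
    intro u t m ht0 ht1 hq hu hv
    rw [abs_le] at hq
    rcases lt_or_gt_of_ne (show u - a * m ≠ 0 by intro h; rw [h, abs_zero] at hu; linarith) with h1 | h1
    · rw [abs_of_neg h1] at hu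
      rcases le_or_gt (u + δ - a * m) 0 with h2 | h2
      · rw [abs_of_nonpos h2] at hv; linarith
      · rw [abs_of_pos h2] at hv; linarith
    · rw [abs_of_pos h1] at hu; linarith
  -- reduce to `y = x + eᵢ`
  wlog h : ∃ i, y = x + Pi.single i 1 generalizing x y
  · obtain ⟨i, h' | h'⟩ := (zdGraph_adj_iff x y).1 hxy
    · exact (h ⟨i, h'⟩).elim
    · rw [segment_symm]
      exact this hxy.symm hy hx ⟨i, h'⟩
  obtain ⟨i, rfl⟩ := h
  intro q hq
  rw [closure_meshPolygon ha]
  by_contra hqA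
  have hqd := mem_meshCell_nearestSite ha q
  set d := nearestSite a q with hd_def
  have hd : d ∉ S := fun h => hqA (mem_iUnion₂.2 ⟨d, h, hqd⟩)
  have hxd : meshPoint δ x ∉ meshCell a d := fun h => (meshCell_disjoint_meshPolygon ha hd).le_bot ⟨h, hx⟩
  have hyd : meshPoint δ (x + Pi.single i 1) ∉ meshCell a d := fun h =>
    (meshCell_disjoint_meshPolygon ha hd).le_bot ⟨h, hy⟩
  obtain ⟨θ, hθ0, hθ1, rfl⟩ : ∃ θ : ℝ, 0 ≤ θ ∧ θ ≤ 1 ∧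
      meshPoint δ x + (θ : ℂ) * (meshPoint δ (x + Pi.single i 1) - meshPoint δ x) = q := by
    rw [segment_eq_image'] at hq
    obtain ⟨θ, ⟨h0, h1⟩, rfl⟩ := hq
    exact ⟨θ, h0, h1, by simp [Complex.real_smul]⟩
  obtain ⟨hq0, hq1⟩ := mem_meshCell_iff.1 hqd
  rw [mem_meshCell_iff, not_and_or, not_le, not_le] at hxd hyd
  simp only [meshPoint_re, meshPoint_im] at hxd hyd
  fin_cases i
  · -- horizontal bond: the ordinate is common, the abscissa moves by `δ`
    simp only [Complex.add_re, Complex.add_im, Complex.mul_re, Complex.mul_im, Complex.ofReal_re,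
      Complex.ofReal_im, Complex.sub_re, Complex.sub_im, meshPoint_re, meshPoint_im, Fin.zero_eta,
      add_single_zero_apply_zero, add_single_zero_apply_one, Int.cast_add, Int.cast_one] at hq0 hq1 hxd hyd
    rcases hyd with hyd | hyd
    · rcases hxd with hxd | hxd
      · refine gap (δ * x 0) (δ * θ) (d 0) (by positivity) (by nlinarith) ?_ ?_ ?_
        · convert hq0 using 2; ring
        · convert hxd using 2
        · have e : δ * (x 0 : ℝ) + δ - a * (d 0 : ℝ) = δ * ((x 0 : ℝ) + 1) - a * (d 0 : ℝ) := by ring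
          rw [e]; exact hyd
      · exact absurd hq1 (not_le.2 (by convert hxd using 2; ring))
    · exact absurd hq1 (not_le.2 (by convert hyd using 2; ring))
  · -- vertical bond
    simp only [Complex.add_re, Complex.add_im, Complex.mul_re, Complex.mul_im, Complex.ofReal_re,
      Complex.ofReal_im, Complex.sub_re, Complex.sub_im, meshPoint_re, meshPoint_im, Fin.mk_one,
      add_single_one_apply_zero, add_single_one_apply_one, Int.cast_add, Int.cast_one] at hq0 hq1 hxd hyd
    rcases hyd with hyd | hyd
    · exact absurd hq0 (not_le.2 (by convert hyd using 2; ring))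
    · rcases hxd with hxd | hxd
      · exact absurd hq0 (not_le.2 (by convert hxd using 2; ring))
      · refine gap (δ * x 1) (δ * θ) (d 1) (by positivity) (by nlinarith) ?_ ?_ ?_
        · convert hq1 using 2; ring
        · convert hxd using 2
        · have e : δ * (x 1 : ℝ) + δ - a * (d 1 : ℝ) = δ * ((x 1 : ℝ) + 1) - a * (d 1 : ℝ) := by ring
          rw [e]; exact hyd

end Fine

/-! ### Walking along a lattice line inside an induced subgraph -/

/-- **Monotone lattice walks.** Let `G` be a graph on `ℤ²`, `T` a set of sites (the induced
subgraph walked in) and `R` a set of sites (the rail). If from every site of `R ∩ T` whose `i`-th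
coordinate differs from `t` there is a `G`-step inside `R ∩ T` strictly decreasing `|xᵢ - t|` and
not changing the other coordinate, then every site `x ∈ R ∩ T` is joined inside `T` to the site
`update x i t` (which belongs to `T`). [folklore] -/
theorem induce_reachable_update {G : SimpleGraph (Site 2)} {T R : Set (Site 2)} (i : Fin 2) (t : ℤ)
    (hstep : ∀ x ∈ R, x ∈ T → x i ≠ t → ∃ x' ∈ R, x' ∈ T ∧ G.Adj x x' ∧
      (x' i - t).natAbs < (x i - t).natAbs ∧ Function.update x' i t = Function.update x i t) :
    ∀ x ∈ R, x ∈ T → Function.update x i t ∈ T ∧ ∀ (hx : x ∈ T) (hy : Function.update x i t ∈ T),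
      (G.induce T).Reachable ⟨x, hx⟩ ⟨Function.update x i t, hy⟩ := by
  intro x
  induction h : (x i - t).natAbs using Nat.strong_induction_on generalizing x with
  | _ n ih =>
    intro hxR hxT
    by_cases hxt : x i = t
    · have he : Function.update x i t = x := by rw [← hxt, Function.update_eq_self]
      refine ⟨he.symm ▸ hxT, fun hx hy => ?_⟩
      have : (⟨Function.update x i t, hy⟩ : T) = ⟨x, hx⟩ := Subtype.ext he
      rw [this]
    · obtain ⟨x', hx'R, hx'T, hadj, hlt, hupd⟩ := hstep x hxR hxT hxt
      obtain ⟨hmem, hreach⟩ := ih _ (h ▸ hlt) x' rfl hx'R hx'T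
      rw [hupd] at hmem hreach
      refine ⟨hmem, fun hx hy => ?_⟩
      have hadj' : (G.induce T).Adj ⟨x, hx⟩ ⟨x', hx'T⟩ := SimpleGraph.comap_adj.2 hadj
      exact hadj'.reachable.trans (hreach hx'T hy)

/-- The unit step from `x₀` towards `t₀ ≠ x₀`. [folklore] -/
def stepTowards (x₀ t₀ : ℤ) : ℤ := if x₀ < t₀ then 1 else -1

/-- The unit step is `±1`. [folklore] -/
theorem stepTowards_eq_or (x₀ t₀ : ℤ) : stepTowards x₀ t₀ = 1 ∨ stepTowards x₀ t₀ = -1 := by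
  unfold stepTowards; split_ifs <;> simp

/-- One step towards the target decreases the lattice distance to it. [folklore] -/
theorem natAbs_add_stepTowards_lt {x₀ t₀ : ℤ} (h : x₀ ≠ t₀) :
    (x₀ + stepTowards x₀ t₀ - t₀).natAbs < (x₀ - t₀).natAbs := by
  unfold stepTowards; split_ifs <;> omega

/-- **One step towards the centre column stays strictly inside the column range** (and so does a
second step when `3δ < a`): if `|δx₀ - ac₀| ≤ a/2`, `|δt₀ - ac₀| ≤ δ/2` and `x₀ ≠ t₀`, then with
`σ` the unit step from `x₀` towards `t₀`, `|δ(x₀ + σ) - ac₀| < a/2` and `|δ(x₀ + 2σ) - ac₀| < a/2`.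
[folklore] -/
theorem abs_step_lt {a δ : ℝ} (hδ : 0 < δ) (h3 : 3 * δ < a) {x₀ t₀ c₀ : ℤ}
    (hx : |δ * x₀ - a * c₀| ≤ a / 2) (ht : |δ * t₀ - a * c₀| ≤ δ / 2) (hne : x₀ ≠ t₀) :
    |δ * ((x₀ + stepTowards x₀ t₀ : ℤ) : ℝ) - a * c₀| < a / 2 ∧
      |δ * ((x₀ + 2 * stepTowards x₀ t₀ : ℤ) : ℝ) - a * c₀| < a / 2 := by
  rw [abs_le] at hx ht
  unfold stepTowards
  split_ifs with hlt
  · have h1 : ((x₀ : ℤ) : ℝ) + 1 ≤ t₀ := by exact_mod_cast Int.add_one_le_iff.2 hlt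
    push_cast
    rw [abs_lt, abs_lt]
    refine ⟨⟨by nlinarith, by nlinarith⟩, by nlinarith, by nlinarith⟩
  · have hgt : t₀ < x₀ := lt_of_le_of_ne (not_lt.1 hlt) (Ne.symm hne)
    have h1 : ((t₀ : ℤ) : ℝ) + 1 ≤ x₀ := by exact_mod_cast Int.add_one_le_iff.2 hgt
    push_cast
    rw [abs_lt, abs_lt]
    refine ⟨⟨by nlinarith, by nlinarith⟩, by nlinarith, by nlinarith⟩

/-- A point whose abscissa is within `a/2` of `a m` lies in a closed cell of the column `m`.
[folklore] -/
theorem mem_meshCell_col {a : ℝ} (ha : 0 < a) {p : ℂ} {m : ℤ} (h : |p.re - a * m| ≤ a / 2) :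
    p ∈ meshCell a ![m, nearestSite a p 1] := by
  refine mem_meshCell_iff.2 ⟨by simpa using h, ?_⟩
  have := (mem_meshCell_iff.1 (mem_meshCell_nearestSite ha p)).2
  simpa using this

/-- A point whose ordinate is within `a/2` of `a m` lies in a closed cell of the row `m`.
[folklore] -/
theorem mem_meshCell_row {a : ℝ} (ha : 0 < a) {p : ℂ} {m : ℤ} (h : |p.im - a * m| ≤ a / 2) :
    p ∈ meshCell a ![nearestSite a p 0, m] := by
  refine mem_meshCell_iff.2 ⟨?_, by simpa using h⟩
  have := (mem_meshCell_iff.1 (mem_meshCell_nearestSite ha p)).1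
  simpa using this

/-- The centre fine site of the coarse cell `c`: the fine site nearest to `a c`. [folklore] -/
def ctr (a δ : ℝ) (c : Site 2) : Site 2 := nearestSite δ (meshPoint a c)

/-- The centre fine site is within `δ/2` of the centre of the coarse cell, coordinatewise. [folklore] -/
theorem abs_ctr_sub_le {a δ : ℝ} (hδ : 0 < δ) (c : Site 2) (j : Fin 2) :
    |δ * (ctr a δ c j : ℝ) - a * c j| ≤ δ / 2 := by
  have h := mem_meshCell_iff.1 (mem_meshCell_nearestSite hδ (meshPoint a c))
  rw [meshPoint_re, meshPoint_im] at h
  fin_cases j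
  · simpa [ctr, abs_sub_comm] using h.1
  · simpa [ctr, abs_sub_comm] using h.2

/-- The centre fine site and its neighbours lie in the open coarse cell (`3δ < a`): every fine
site within lattice distance `1` of `ctr` in each coordinate. [folklore] -/
theorem meshPoint_mem_openCell_of_near_ctr {a δ : ℝ} (hδ : 0 < δ) (h3 : 3 * δ < a) {c y : Site 2}
    (hy : ∀ j, |y j - ctr a δ c j| ≤ 1) : meshPoint δ y ∈ openCell a c := by
  have key : ∀ j : Fin 2, |δ * (y j : ℝ) - a * c j| < a / 2 := by
    intro j
    have h1 := abs_ctr_sub_le (a := a) hδ c j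
    have h2 : |((y j : ℤ) : ℝ) - (ctr a δ c j : ℝ)| ≤ 1 := by exact_mod_cast hy j
    calc |δ * (y j : ℝ) - a * c j| = |δ * ((y j : ℝ) - ctr a δ c j) + (δ * (ctr a δ c j : ℝ) - a * c j)| := by
          ring_nf
      _ ≤ |δ * ((y j : ℝ) - ctr a δ c j)| + |δ * (ctr a δ c j : ℝ) - a * c j| := abs_add_le _ _
      _ ≤ δ * 1 + δ / 2 := by
          rw [abs_mul, abs_of_pos hδ]
          exact add_le_add (mul_le_mul_of_nonneg_left h2 hδ.le) h1
      _ < a / 2 := by linarith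
  rw [mem_openCell_iff, meshPoint_re, meshPoint_im]
  exact ⟨key 0, key 1⟩

/-- The mesh point of the centre fine site lies in the open coarse cell (`3δ < a`). [folklore] -/
theorem meshPoint_ctr_mem_openCell {a δ : ℝ} (hδ : 0 < δ) (h3 : 3 * δ < a) (c : Site 2) :
    meshPoint δ (ctr a δ c) ∈ openCell a c :=
  meshPoint_mem_openCell_of_near_ctr hδ h3 fun j => by simp

/-- The mesh points of the neighbours of the centre fine site lie in the open coarse cell (`3δ < a`). [folklore] -/
theorem meshPoint_mem_openCell_of_adj_ctr {a δ : ℝ} (hδ : 0 < δ) (h3 : 3 * δ < a) {c y : Site 2}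
    (hy : (zdGraph 2).Adj (ctr a δ c) y) : meshPoint δ y ∈ openCell a c := by
  refine meshPoint_mem_openCell_of_near_ctr hδ h3 fun j => ?_
  obtain ⟨i, h | h⟩ := (zdGraph_adj_iff _ _).1 hy
  · rw [h, Pi.add_apply, Pi.single_apply]
    split_ifs <;> simp
  · rw [h, Pi.add_apply, Pi.single_apply]
    split_ifs <;> simp

/-! ### The fine mesh graph of a coarse polyomino is connected -/

section FineGraph

variable {a δ : ℝ} {S : Set (Site 2)}

/-- Horizontal walk of a fine site of the polyomino domain towards the centre column of its coarse
cell, inside the fine mesh graph (`3δ < a`). [folklore] -/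
theorem meshVertexGraph_reachable_update_zero (ha : 0 < a) (hδ : 0 < δ) (h3 : 3 * δ < a) {c₀ t₀ : ℤ}
    (ht : |δ * t₀ - a * c₀| ≤ δ / 2) {x : Site 2} (hxc : |δ * x 0 - a * c₀| ≤ a / 2)
    (hx : x ∈ meshVertices (meshPolygon S a) δ) :
    Function.update x 0 t₀ ∈ meshVertices (meshPolygon S a) δ ∧
      ∀ (hx : x ∈ meshVertices (meshPolygon S a) δ) (hy : Function.update x 0 t₀ ∈ meshVertices (meshPolygon S a) δ),
        (meshVertexGraph (meshPolygon S a) δ).Reachable ⟨x, hx⟩ ⟨Function.update x 0 t₀, hy⟩ := by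
  refine induce_reachable_update (R := {x : Site 2 | |δ * x 0 - a * c₀| ≤ a / 2}) 0 t₀ ?_ x hxc hx
  intro x hxR hxT hne
  obtain ⟨h1, -⟩ := abs_step_lt hδ h3 hxR ht hne
  set x' : Site 2 := x + Pi.single 0 (stepTowards (x 0) t₀) with hx'
  have hx'0 : x' 0 = x 0 + stepTowards (x 0) t₀ := by simp [hx']
  have hx'1 : x' 1 = x 1 := by simp [hx']
  have hx'R : |δ * (x' 0 : ℝ) - a * c₀| < a / 2 := by rw [hx'0]; exact h1
  -- the new site lies in the domain, by the row lemma from `δx`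
  have hx'P : meshPoint δ x' ∈ meshPolygon S a := by
    refine mem_meshPolygon_of_re ha hxT (mem_meshCell_col ha (by simpa using hxR)) ?_ ?_
    · rw [meshPoint_im, meshPoint_im, hx'1]
    · simpa using hx'R
  have hadj : (zdGraph 2).Adj x x' := zdGraph_adj_add_single x 0 (stepTowards_eq_or _ _)
  refine ⟨x', hx'R.le, hx'P, ?_, ?_, ?_⟩
  · exact meshGraph_adj_iff.2 ⟨hadj, segment_subset_closure_meshPolygon ha hδ (by linarith) hadj hxT hx'P⟩
  · rw [hx'0]; exact natAbs_add_stepTowards_lt hne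
  · ext j; fin_cases j
    · simp
    · simp [hx'1]

/-- Vertical walk of a fine site of the polyomino domain in the centre column of its coarse cell
towards the centre row, inside the fine mesh graph (`3δ < a`). [folklore] -/
theorem meshVertexGraph_reachable_update_one (ha : 0 < a) (hδ : 0 < δ) (h3 : 3 * δ < a) {c : Site 2} {t₁ : ℤ}
    (ht : |δ * t₁ - a * c 1| ≤ δ / 2) {x : Site 2} (hx0 : |δ * x 0 - a * c 0| ≤ a / 2)
    (hxc : |δ * x 1 - a * c 1| ≤ a / 2) (hx : x ∈ meshVertices (meshPolygon S a) δ) :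
    Function.update x 1 t₁ ∈ meshVertices (meshPolygon S a) δ ∧
      ∀ (hx : x ∈ meshVertices (meshPolygon S a) δ) (hy : Function.update x 1 t₁ ∈ meshVertices (meshPolygon S a) δ),
        (meshVertexGraph (meshPolygon S a) δ).Reachable ⟨x, hx⟩ ⟨Function.update x 1 t₁, hy⟩ := by
  refine induce_reachable_update (R := {x : Site 2 | |δ * x 0 - a * c 0| ≤ a / 2 ∧ |δ * x 1 - a * c 1| ≤ a / 2})
    1 t₁ ?_ x ⟨hx0, hxc⟩ hx
  rintro x ⟨hxR0, hxR1⟩ hxT hne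
  obtain ⟨h1, -⟩ := abs_step_lt hδ h3 hxR1 ht hne
  set x' : Site 2 := x + Pi.single 1 (stepTowards (x 1) t₁) with hx'
  have hx'1 : x' 1 = x 1 + stepTowards (x 1) t₁ := by simp [hx']
  have hx'0 : x' 0 = x 0 := by simp [hx']
  have hx'R : |δ * (x' 1 : ℝ) - a * c 1| < a / 2 := by rw [hx'1]; exact h1
  have hxc' : meshPoint δ x ∈ meshCell a c := by
    rw [mem_meshCell_iff, meshPoint_re, meshPoint_im]; exact ⟨hxR0, hxR1⟩
  have hx'P : meshPoint δ x' ∈ meshPolygon S a := by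
    refine mem_meshPolygon_of_im ha hxT hxc' ?_ ?_
    · rw [meshPoint_re, meshPoint_re, hx'0]
    · simpa using hx'R
  have hadj : (zdGraph 2).Adj x x' := zdGraph_adj_add_single x 1 (stepTowards_eq_or _ _)
  refine ⟨x', ⟨by simpa [hx'0] using hxR0, hx'R.le⟩, hx'P, ?_, ?_, ?_⟩
  · exact meshGraph_adj_iff.2 ⟨hadj, segment_subset_closure_meshPolygon ha hδ (by linarith) hadj hxT hx'P⟩
  · rw [hx'1]; exact natAbs_add_stepTowards_lt hne
  · ext j; fin_cases j
    · simp [hx'0]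
    · simp

/-- **Every fine site of the polyomino domain is joined in the fine mesh graph to the centre fine
site of its coarse cell** (`3δ < a`). [folklore] -/
theorem meshVertexGraph_reachable_ctr (ha : 0 < a) (hδ : 0 < δ) (h3 : 3 * δ < a) {c x : Site 2}
    (hxc : meshPoint δ x ∈ meshCell a c) (hx : x ∈ meshVertices (meshPolygon S a) δ) :
    ∃ h : ctr a δ c ∈ meshVertices (meshPolygon S a) δ,
      (meshVertexGraph (meshPolygon S a) δ).Reachable ⟨x, hx⟩ ⟨ctr a δ c, h⟩ := by
  obtain ⟨hxc0, hxc1⟩ := mem_meshCell_iff.1 hxc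
  rw [meshPoint_re] at hxc0
  rw [meshPoint_im] at hxc1
  have ht0 := abs_ctr_sub_le (a := a) hδ c 0
  have ht1 := abs_ctr_sub_le (a := a) hδ c 1
  obtain ⟨hmid, hreach1⟩ := meshVertexGraph_reachable_update_zero (S := S) ha hδ h3 ht0 hxc0 hx
  have hmid0 : |δ * (Function.update x 0 (ctr a δ c 0) 0 : ℝ) - a * c 0| ≤ a / 2 := by
    simp only [Function.update_self]; linarith [abs_nonneg (δ * (ctr a δ c 0 : ℝ) - a * c 0)]
  have hmid1 : |δ * (Function.update x 0 (ctr a δ c 0) 1 : ℝ) - a * c 1| ≤ a / 2 := by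
    simpa using hxc1
  obtain ⟨hend, hreach2⟩ := meshVertexGraph_reachable_update_one (S := S) ha hδ h3 ht1 hmid0 hmid1 hmid
  have he : Function.update (Function.update x 0 (ctr a δ c 0)) 1 (ctr a δ c 1) = ctr a δ c := by
    ext j; fin_cases j <;> simp
  rw [he] at hend hreach2
  exact ⟨hend, (hreach1 hx hmid).trans (hreach2 hmid hend)⟩

/-- The centre fine site of a coarse cell of `S` is a fine site of the polyomino domain
(`3δ < a`). [folklore] -/
theorem ctr_mem_meshVertices (hδ : 0 < δ) (h3 : 3 * δ < a) {c : Site 2} (hc : c ∈ S) :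
    ctr a δ c ∈ meshVertices (meshPolygon S a) δ :=
  openCell_subset_meshPolygon hc (meshPoint_ctr_mem_openCell hδ h3 c)

/-- The rectangle spanned by the mesh points of the centre fine sites of `c` and `c + eᵢ` lies in
their double box (`3δ < a`). [folklore] -/
theorem rectangle_ctr_subset_box (hδ : 0 < δ) (h3 : 3 * δ < a) (c : Site 2) (i : Fin 2) :
    Complex.Rectangle (meshPoint δ (ctr a δ c)) (meshPoint δ (ctr a δ (c + Pi.single i 1))) ⊆ box a c i := by
  have h0 := abs_le.1 (abs_ctr_sub_le (a := a) hδ c 0)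
  have h1 := abs_le.1 (abs_ctr_sub_le (a := a) hδ c 1)
  fin_cases i
  · simp only [Fin.zero_eta, box_zero]
    intro z hz
    obtain ⟨hzre, hzim⟩ := hz
    rw [meshPoint_re, meshPoint_re] at hzre
    rw [meshPoint_im, meshPoint_im] at hzim
    have h0' := abs_le.1 (abs_ctr_sub_le (a := a) hδ (c + Pi.single 0 1) 0)
    have h1' := abs_le.1 (abs_ctr_sub_le (a := a) hδ (c + Pi.single 0 1) 1)
    simp only [add_single_zero_apply_zero, add_single_zero_apply_one, Int.cast_add, Int.cast_one] at h0' h1'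
    simp only [mem_hBox]
    rcases mem_uIcc.1 hzre with ⟨hr1, hr2⟩ | ⟨hr1, hr2⟩ <;>
    rcases mem_uIcc.1 hzim with ⟨hi1, hi2⟩ | ⟨hi1, hi2⟩ <;>
    exact ⟨by linarith, by linarith, by linarith, by linarith⟩
  · simp only [Fin.mk_one, box_one]
    intro z hz
    obtain ⟨hzre, hzim⟩ := hz
    rw [meshPoint_re, meshPoint_re] at hzre
    rw [meshPoint_im, meshPoint_im] at hzim
    have h0' := abs_le.1 (abs_ctr_sub_le (a := a) hδ (c + Pi.single 1 1) 0)
    have h1' := abs_le.1 (abs_ctr_sub_le (a := a) hδ (c + Pi.single 1 1) 1)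
    simp only [add_single_one_apply_zero, add_single_one_apply_one, Int.cast_add, Int.cast_one] at h0' h1'
    simp only [mem_vBox]
    rcases mem_uIcc.1 hzre with ⟨hr1, hr2⟩ | ⟨hr1, hr2⟩ <;>
    rcases mem_uIcc.1 hzim with ⟨hi1, hi2⟩ | ⟨hi1, hi2⟩ <;>
    exact ⟨by linarith, by linarith, by linarith, by linarith⟩

/-- The centre fine sites of two adjacent coarse cells of `S` are joined in the fine mesh graph
(by a straight fine walk inside their double box; `3δ < a`). [folklore] -/
theorem meshVertexGraph_reachable_ctr_ctr (hδ : 0 < δ) (h3 : 3 * δ < a) {c : Site 2} {i : Fin 2}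
    (hc : c ∈ S) (hc' : c + Pi.single i 1 ∈ S) :
    (meshVertexGraph (meshPolygon S a) δ).Reachable ⟨ctr a δ c, ctr_mem_meshVertices hδ h3 hc⟩
      ⟨ctr a δ (c + Pi.single i 1), ctr_mem_meshVertices hδ h3 hc'⟩ :=
  meshVertexGraph_reachable_of_rectangle_subset hδ _ _ _ rfl
    ((rectangle_ctr_subset_box hδ h3 c i).trans (box_subset_meshPolygon hc hc')) _ _

/-- Chaining along a lattice path of `S`: the centre fine sites of two lattice-connected coarse
cells of `S` are joined in the fine mesh graph. [folklore] -/
theorem meshVertexGraph_reachable_ctr_of_reachable (hδ : 0 < δ) (h3 : 3 * δ < a) {c d : S}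
    (h : ((zdGraph 2).induce S).Reachable c d) :
    (meshVertexGraph (meshPolygon S a) δ).Reachable ⟨ctr a δ c, ctr_mem_meshVertices hδ h3 c.2⟩
      ⟨ctr a δ d, ctr_mem_meshVertices hδ h3 d.2⟩ := by
  rw [SimpleGraph.reachable_iff_reflTransGen] at h
  induction h with
  | refl => rfl
  | @tail b e _ hbe ih =>
    refine ih.trans ?_
    have hadj : (zdGraph 2).Adj (b : Site 2) e := SimpleGraph.comap_adj.1 hbe
    obtain ⟨i, he | hb⟩ := (zdGraph_adj_iff _ _).1 hadj
    · have he' : (b : Site 2) + Pi.single i 1 ∈ S := he ▸ e.2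
      have := meshVertexGraph_reachable_ctr_ctr (a := a) hδ h3 b.2 he'
      convert this using 3
    · have hb' : (e : Site 2) + Pi.single i 1 ∈ S := hb ▸ b.2
      have := (meshVertexGraph_reachable_ctr_ctr (a := a) hδ h3 e.2 hb').symm
      convert this using 3

/-- **The fine mesh graph of a polyomino domain on a lattice-connected set of coarse cells is
preconnected** (`3δ < a`). [folklore] -/
theorem meshVertexGraph_preconnected (ha : 0 < a) (hδ : 0 < δ) (h3 : 3 * δ < a)
    (hS : ((zdGraph 2).induce S).Preconnected) : (meshVertexGraph (meshPolygon S a) δ).Preconnected := by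
  rintro ⟨u, hu⟩ ⟨v, hv⟩
  have huc := mem_meshCell_nearestSite ha (meshPoint δ u)
  have hvc := mem_meshCell_nearestSite ha (meshPoint δ v)
  have hcu : nearestSite a (meshPoint δ u) ∈ S := mem_of_mem_meshPolygon ha hu huc
  have hcv : nearestSite a (meshPoint δ v) ∈ S := mem_of_mem_meshPolygon ha hv hvc
  obtain ⟨_, hru⟩ := meshVertexGraph_reachable_ctr ha hδ h3 huc hu
  obtain ⟨_, hrv⟩ := meshVertexGraph_reachable_ctr ha hδ h3 hvc hv
  exact (hru.trans (meshVertexGraph_reachable_ctr_of_reachable hδ h3 (c := ⟨_, hcu⟩) (d := ⟨_, hcv⟩)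
    (hS _ _))).trans hrv.symm

/-- **For a polyomino domain the discrete domain ("the largest component") is all of the fine
sites** (`3δ < a`, `S` lattice connected). [folklore] -/
theorem meshDomain_meshPolygon_eq (ha : 0 < a) (hδ : 0 < δ) (h3 : 3 * δ < a)
    (hS : ((zdGraph 2).induce S).Preconnected) :
    meshDomain (meshPolygon S a) δ = meshVertices (meshPolygon S a) δ := by
  refine Subset.antisymm (meshDomain_subset_meshVertices _ _) fun v hv => ?_
  have hsub := (meshVertexGraph_preconnected ha hδ h3 hS).subsingleton_connectedComponent
  simp only [meshDomain, mem_iUnion, mem_image]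
  refine ⟨(meshVertexGraph (meshPolygon S a) δ).connectedComponentMk ⟨v, hv⟩, fun C' => ?_, ⟨v, hv⟩, ?_, rfl⟩
  · rw [Subsingleton.elim C' ((meshVertexGraph (meshPolygon S a) δ).connectedComponentMk ⟨v, hv⟩)]
  · rw [SimpleGraph.ConnectedComponent.mem_supp_iff]

/-- The graph `Ω_δ` of a polyomino domain is `ℤ²` restricted to its fine sites (`3δ < a`, `S`
lattice connected). [folklore] -/
theorem discreteDomainGraph_adj_iff' (ha : 0 < a) (hδ : 0 < δ) (h3 : 3 * δ < a)
    (hS : ((zdGraph 2).induce S).Preconnected) {u v : Site 2} :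
    (discreteDomainGraph (meshPolygon S a) δ).Adj u v ↔ (zdGraph 2).Adj u v ∧
      meshPoint δ u ∈ meshPolygon S a ∧ meshPoint δ v ∈ meshPolygon S a := by
  rw [discreteDomainGraph_adj_iff, meshDomain_meshPolygon_eq ha hδ h3 hS, mem_meshVertices_iff,
    mem_meshVertices_iff]
  constructor
  · rintro ⟨h, hu, hv⟩
    exact ⟨meshGraph_le_zdGraph _ _ h, hu, hv⟩
  · rintro ⟨h, hu, hv⟩
    exact ⟨meshGraph_adj_iff.2 ⟨h, segment_subset_closure_meshPolygon ha hδ (by linarith) h hu hv⟩, hu, hv⟩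

/-- **The interior (free) sites of a polyomino domain**: for `3δ < a`, `S` finite and lattice
connected, a fine site is an interior site of `Ω_δ` iff its mesh point and those of its four
`ℤ²`-neighbours lie in the polyomino domain. [folklore] -/
theorem mem_meshInteriorFinset_meshPolygon_iff (ha : 0 < a) (hδ : 0 < δ) (h3 : 3 * δ < a) (hfin : S.Finite)
    (hS : ((zdGraph 2).induce S).Preconnected) {x : Site 2} :
    x ∈ meshInteriorFinset (meshPolygon S a) δ ↔
      meshPoint δ x ∈ meshPolygon S a ∧ ∀ y, (zdGraph 2).Adj x y → meshPoint δ y ∈ meshPolygon S a := by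
  have hbdd : Bornology.IsBounded (meshPolygon S a) := (isBounded_biUnion_meshCell hfin a).subset interior_subset
  rw [← Finset.mem_coe, coe_meshInteriorFinset hbdd hδ, Set.mem_sdiff, meshDomain_meshPolygon_eq ha hδ h3 hS,
    mem_meshBoundary_iff, meshDomain_meshPolygon_eq ha hδ h3 hS, mem_meshVertices_iff]
  constructor
  · rintro ⟨hx, hnb⟩
    refine ⟨hx, fun y hy => ?_⟩
    by_contra hy'
    exact hnb ⟨hx, y, hy, fun hadj => hy' ((discreteDomainGraph_adj_iff' ha hδ h3 hS).1 hadj).2.2⟩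
  · rintro ⟨hx, hall⟩
    refine ⟨hx, ?_⟩
    rintro ⟨-, y, hy, hnadj⟩
    exact hnadj ((discreteDomainGraph_adj_iff' ha hδ h3 hS).2 ⟨hy, hx, hall y hy⟩)

end FineGraph

/-! ### The interior fine sites of a coarse polyomino: nonempty and lattice connected -/

section Interior

variable {a δ : ℝ} {S : Set (Site 2)}

/-- The interior (free) fine sites of the polyomino domain of `S`: the fine sites whose mesh point
and those of their four `ℤ²`-neighbours lie in the domain (`= meshInteriorFinset`, see
`mem_meshInteriorFinset_meshPolygon_iff`). [folklore] -/
def intSites (S : Set (Site 2)) (a δ : ℝ) : Set (Site 2) :=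
  {x | meshPoint δ x ∈ meshPolygon S a ∧ ∀ y, (zdGraph 2).Adj x y → meshPoint δ y ∈ meshPolygon S a}

/-- Membership in `intSites`, unfolded. [folklore] -/
theorem mem_intSites {x : Site 2} : x ∈ intSites S a δ ↔
    meshPoint δ x ∈ meshPolygon S a ∧ ∀ y, (zdGraph 2).Adj x y → meshPoint δ y ∈ meshPolygon S a := Iff.rfl

/-- The centre fine site of a coarse cell of `S` is an interior site (`3δ < a`). [folklore] -/
theorem ctr_mem_intSites (hδ : 0 < δ) (h3 : 3 * δ < a) {c : Site 2} (hc : c ∈ S) : ctr a δ c ∈ intSites S a δ :=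
  ⟨openCell_subset_meshPolygon hc (meshPoint_ctr_mem_openCell hδ h3 c),
    fun _ hy => openCell_subset_meshPolygon hc (meshPoint_mem_openCell_of_adj_ctr hδ h3 hy)⟩

/-- Interior sites exist (`S` nonempty, `3δ < a`). [folklore] -/
theorem intSites_nonempty (hδ : 0 < δ) (h3 : 3 * δ < a) (hne : S.Nonempty) : (intSites S a δ).Nonempty :=
  ⟨_, ctr_mem_intSites hδ h3 hne.some_mem⟩

/-- Interior sites are fine sites of the domain; in particular there are finitely many of them when
`S` is finite. [folklore] -/
theorem intSites_finite (hδ : 0 < δ) (hfin : S.Finite) : (intSites S a δ).Finite :=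
  (meshVertices_finite ((isBounded_biUnion_meshCell hfin a).subset interior_subset) hδ).subset fun _ hx => hx.1

/-- Row transfer: from a point `δu` of the domain in the column range of `c₀`, every fine site on
the same row whose abscissa is strictly in the column range, or equal to that of `u`, has its mesh
point in the domain. [folklore] -/
theorem meshPoint_mem_of_row (ha : 0 < a) {c₀ : ℤ} {u y : Site 2} (hu : meshPoint δ u ∈ meshPolygon S a)
    (hu0 : |δ * u 0 - a * c₀| ≤ a / 2) (h1 : y 1 = u 1) (h0 : |δ * y 0 - a * c₀| < a / 2 ∨ y 0 = u 0) :
    meshPoint δ y ∈ meshPolygon S a := by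
  rcases h0 with h0 | h0
  · refine mem_meshPolygon_of_re ha hu (mem_meshCell_col ha (by simpa using hu0)) ?_ (by simpa using h0)
    rw [meshPoint_im, meshPoint_im, h1]
  · have : y = u := by ext j; fin_cases j <;> simp [h0, h1]
    rwa [this]

/-- Column transfer (the row transfer with the coordinates exchanged). [folklore] -/
theorem meshPoint_mem_of_col (ha : 0 < a) {c : Site 2} {u y : Site 2} (hu : meshPoint δ u ∈ meshPolygon S a)
    (hu0 : |δ * u 0 - a * c 0| ≤ a / 2) (hu1 : |δ * u 1 - a * c 1| ≤ a / 2) (h0 : y 0 = u 0)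
    (h1 : |δ * y 1 - a * c 1| < a / 2 ∨ y 1 = u 1) : meshPoint δ y ∈ meshPolygon S a := by
  rcases h1 with h1 | h1
  · have huc : meshPoint δ u ∈ meshCell a c := by
      rw [mem_meshCell_iff, meshPoint_re, meshPoint_im]; exact ⟨hu0, hu1⟩
    refine mem_meshPolygon_of_im ha hu huc ?_ (by simpa using h1)
    rw [meshPoint_re, meshPoint_re, h0]
  · have : y = u := by ext j; fin_cases j <;> simp [h0, h1]
    rwa [this]

/-- After a unit step `σ` from `x₀` towards the centre, the two sites at distance one along the
line are `x₀` itself and `x₀ + 2σ`; so each is either strictly in the column range or equal to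
`x₀`. [folklore] -/
theorem abs_lt_or_eq_of_step {x₀ c₀ m : ℤ} {σ : ℤ} (hσ : σ = 1 ∨ σ = -1)
    (h2 : |δ * ((x₀ + 2 * σ : ℤ) : ℝ) - a * c₀| < a / 2) (hm : m = x₀ + σ + 1 ∨ m = x₀ + σ - 1) :
    |δ * (m : ℝ) - a * c₀| < a / 2 ∨ m = x₀ := by
  rcases hσ with rfl | rfl <;> rcases hm with rfl | rfl
  · left; convert h2 using 4; push_cast; ring
  · right; ring
  · right; ring
  · left; convert h2 using 4; push_cast; ring

/-- Coordinates of the two `ℤ²`-neighbours of `x'` along direction `0` and direction `1`. [folklore] -/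
theorem coords_of_adj {x' y : Site 2} (h : (zdGraph 2).Adj x' y) :
    (y 1 = x' 1 ∧ (y 0 = x' 0 + 1 ∨ y 0 = x' 0 - 1)) ∨ (y 0 = x' 0 ∧ (y 1 = x' 1 + 1 ∨ y 1 = x' 1 - 1)) := by
  obtain ⟨k, rfl | rfl⟩ := (zdGraph_adj_iff x' y).1 h <;> fin_cases k <;> simp

/-- Horizontal walk of an interior site towards the centre column of its coarse cell, inside the
interior sites (`3δ < a`). [folklore] -/
theorem intSites_reachable_update_zero (ha : 0 < a) (hδ : 0 < δ) (h3 : 3 * δ < a) {c₀ t₀ : ℤ}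
    (ht : |δ * t₀ - a * c₀| ≤ δ / 2) {x : Site 2} (hxc : |δ * x 0 - a * c₀| ≤ a / 2) (hx : x ∈ intSites S a δ) :
    Function.update x 0 t₀ ∈ intSites S a δ ∧
      ∀ (hx : x ∈ intSites S a δ) (hy : Function.update x 0 t₀ ∈ intSites S a δ),
        ((zdGraph 2).induce (intSites S a δ)).Reachable ⟨x, hx⟩ ⟨Function.update x 0 t₀, hy⟩ := by
  refine induce_reachable_update (R := {x : Site 2 | |δ * x 0 - a * c₀| ≤ a / 2}) 0 t₀ ?_ x hxc hx
  intro x hxR hxT hne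
  obtain ⟨h1, h2⟩ := abs_step_lt hδ h3 hxR ht hne
  have hσ := stepTowards_eq_or (x 0) t₀
  set σ := stepTowards (x 0) t₀ with hσ_def
  set x' : Site 2 := x + Pi.single 0 σ with hx'
  have hx'0 : x' 0 = x 0 + σ := by simp [hx']
  have hx'1 : x' 1 = x 1 := by simp [hx']
  have hx'R : |δ * (x' 0 : ℝ) - a * c₀| < a / 2 := by rw [hx'0]; exact h1
  have hadj : (zdGraph 2).Adj x x' := zdGraph_adj_add_single x 0 hσ
  have hx'P : meshPoint δ x' ∈ meshPolygon S a := hxT.2 x' hadj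
  -- the new site is interior: its four neighbours, by the row lemma from `x` and from `x ± e₁`
  have hx'T : x' ∈ intSites S a δ := by
    refine ⟨hx'P, fun y hy => ?_⟩
    rcases coords_of_adj hy with ⟨hy1, hy0⟩ | ⟨hy0, hy1⟩
    · rw [hx'0] at hy0
      rw [hx'1] at hy1
      exact meshPoint_mem_of_row ha hxT.1 hxR hy1 (abs_lt_or_eq_of_step hσ h2 hy0)
    · rw [hx'1] at hy1
      rw [hx'0] at hy0
      rcases hy1 with hy1 | hy1
      · have hu : meshPoint δ (x + Pi.single 1 1) ∈ meshPolygon S a :=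
          hxT.2 _ (zdGraph_adj_add_single x 1 (Or.inl rfl))
        exact meshPoint_mem_of_row ha hu (by simpa using hxR) (by simp [hy1]) (Or.inl (by simpa [hy0] using h1))
      · have hu : meshPoint δ (x + Pi.single 1 (-1)) ∈ meshPolygon S a :=
          hxT.2 _ (zdGraph_adj_add_single x 1 (Or.inr rfl))
        exact meshPoint_mem_of_row ha hu (by simpa using hxR) (by simp [hy1, sub_eq_add_neg])
          (Or.inl (by simpa [hy0] using h1))
  refine ⟨x', hx'R.le, hx'T, hadj, ?_, ?_⟩
  · rw [hx'0]; exact natAbs_add_stepTowards_lt hne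
  · ext j; fin_cases j
    · simp
    · simp [hx'1]

/-- The sites of the centre column `t₀` and of its two neighbouring columns are in the column range
(`3δ < a`). [folklore] -/
theorem abs_col_le_of_near {c₀ t₀ m : ℤ} (hδ : 0 < δ) (h3 : 3 * δ < a) (ht : |δ * t₀ - a * c₀| ≤ δ / 2)
    (hm : m = t₀ ∨ m = t₀ + 1 ∨ m = t₀ - 1) : |δ * (m : ℝ) - a * c₀| ≤ a / 2 := by
  rw [abs_le] at ht ⊢
  rcases hm with rfl | rfl | rfl <;> push_cast <;> constructor <;> nlinarith

/-- Vertical walk of an interior site in the centre column of its coarse cell towards the centre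
row, inside the interior sites (`3δ < a`). [folklore] -/
theorem intSites_reachable_update_one (ha : 0 < a) (hδ : 0 < δ) (h3 : 3 * δ < a) {c : Site 2} {t₀ t₁ : ℤ}
    (ht0 : |δ * t₀ - a * c 0| ≤ δ / 2) (ht : |δ * t₁ - a * c 1| ≤ δ / 2) {x : Site 2} (hx0 : x 0 = t₀)
    (hxc : |δ * x 1 - a * c 1| ≤ a / 2) (hx : x ∈ intSites S a δ) :
    Function.update x 1 t₁ ∈ intSites S a δ ∧
      ∀ (hx : x ∈ intSites S a δ) (hy : Function.update x 1 t₁ ∈ intSites S a δ),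
        ((zdGraph 2).induce (intSites S a δ)).Reachable ⟨x, hx⟩ ⟨Function.update x 1 t₁, hy⟩ := by
  refine induce_reachable_update (R := {x : Site 2 | x 0 = t₀ ∧ |δ * x 1 - a * c 1| ≤ a / 2})
    1 t₁ ?_ x ⟨hx0, hxc⟩ hx
  rintro x ⟨hxR0, hxR1⟩ hxT hne
  obtain ⟨h1, h2⟩ := abs_step_lt hδ h3 hxR1 ht hne
  have hσ := stepTowards_eq_or (x 1) t₁
  set σ := stepTowards (x 1) t₁ with hσ_def
  set x' : Site 2 := x + Pi.single 1 σ with hx'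
  have hx'1 : x' 1 = x 1 + σ := by simp [hx']
  have hx'0 : x' 0 = x 0 := by simp [hx']
  have hx'R : |δ * (x' 1 : ℝ) - a * c 1| < a / 2 := by rw [hx'1]; exact h1
  have hadj : (zdGraph 2).Adj x x' := zdGraph_adj_add_single x 1 hσ
  have hx'P : meshPoint δ x' ∈ meshPolygon S a := hxT.2 x' hadj
  have hxcol : |δ * (x 0 : ℝ) - a * c 0| ≤ a / 2 := abs_col_le_of_near hδ h3 ht0 (Or.inl hxR0)
  have hx'T : x' ∈ intSites S a δ := by
    refine ⟨hx'P, fun y hy => ?_⟩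
    rcases coords_of_adj hy with ⟨hy1, hy0⟩ | ⟨hy0, hy1⟩
    · rw [hx'1] at hy1
      rw [hx'0] at hy0
      rcases hy0 with hy0 | hy0
      · have hu : meshPoint δ (x + Pi.single 0 1) ∈ meshPolygon S a :=
          hxT.2 _ (zdGraph_adj_add_single x 0 (Or.inl rfl))
        refine meshPoint_mem_of_col ha hu ?_ (by simpa using hxR1) (by simp [hy0]) (Or.inl (by simpa [hy1] using h1))
        have := abs_col_le_of_near (a := a) (m := x 0 + 1) hδ h3 ht0 (Or.inr (Or.inl (by rw [hxR0])))
        simpa using this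
      · have hu : meshPoint δ (x + Pi.single 0 (-1)) ∈ meshPolygon S a :=
          hxT.2 _ (zdGraph_adj_add_single x 0 (Or.inr rfl))
        refine meshPoint_mem_of_col ha hu ?_ (by simpa using hxR1) (by simp [hy0, sub_eq_add_neg])
          (Or.inl (by simpa [hy1] using h1))
        have := abs_col_le_of_near (a := a) (m := x 0 - 1) hδ h3 ht0 (Or.inr (Or.inr (by rw [hxR0])))
        simpa [sub_eq_add_neg] using this
    · rw [hx'0] at hy0
      rw [hx'1] at hy1
      exact meshPoint_mem_of_col ha hxT.1 hxcol hxR1 hy0 (abs_lt_or_eq_of_step hσ h2 hy1)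
  refine ⟨x', ⟨by rw [hx'0, hxR0], hx'R.le⟩, hx'T, hadj, ?_, ?_⟩
  · rw [hx'1]; exact natAbs_add_stepTowards_lt hne
  · ext j; fin_cases j
    · simp [hx'0]
    · simp

/-- **Every interior site is joined through interior sites to the centre fine site of its coarse
cell** (`3δ < a`). [folklore] -/
theorem intSites_reachable_ctr (ha : 0 < a) (hδ : 0 < δ) (h3 : 3 * δ < a) {c x : Site 2}
    (hxc : meshPoint δ x ∈ meshCell a c) (hx : x ∈ intSites S a δ) :
    ∃ h : ctr a δ c ∈ intSites S a δ,
      ((zdGraph 2).induce (intSites S a δ)).Reachable ⟨x, hx⟩ ⟨ctr a δ c, h⟩ := by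
  obtain ⟨hxc0, hxc1⟩ := mem_meshCell_iff.1 hxc
  rw [meshPoint_re] at hxc0
  rw [meshPoint_im] at hxc1
  have ht0 := abs_ctr_sub_le (a := a) hδ c 0
  have ht1 := abs_ctr_sub_le (a := a) hδ c 1
  obtain ⟨hmid, hreach1⟩ := intSites_reachable_update_zero (S := S) ha hδ h3 ht0 hxc0 hx
  have hmid1 : |δ * (Function.update x 0 (ctr a δ c 0) 1 : ℝ) - a * c 1| ≤ a / 2 := by simpa using hxc1
  obtain ⟨hend, hreach2⟩ := intSites_reachable_update_one (S := S) ha hδ h3 ht0 ht1 (by simp) hmid1 hmid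
  have he : Function.update (Function.update x 0 (ctr a δ c 0)) 1 (ctr a δ c 1) = ctr a δ c := by
    ext j; fin_cases j <;> simp
  rw [he] at hend hreach2
  exact ⟨hend, (hreach1 hx hmid).trans (hreach2 hmid hend)⟩

/-- Along the straight fine walk from the centre fine site of `c` to that of `c + eᵢ`, every site
and its neighbours have their mesh points in the double box (`3δ < a`). [folklore] -/
theorem meshPoint_mem_box_of_between (hδ : 0 < δ) (h3 : 3 * δ < a) {c : Site 2} {i : Fin 2} {x y : Site 2}
    (hxi : x i ∈ uIcc (ctr a δ c i) (ctr a δ (c + Pi.single i 1) i))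
    (hxj : ∀ j, j ≠ i → x j = ctr a δ c j) (hy : ∀ j, |y j - x j| ≤ 1) :
    meshPoint δ y ∈ box a c i := by
  have h0 := abs_le.1 (abs_ctr_sub_le (a := a) hδ c 0)
  have h1 := abs_le.1 (abs_ctr_sub_le (a := a) hδ c 1)
  have hy0 : |((y 0 : ℤ) : ℝ) - x 0| ≤ 1 := by exact_mod_cast hy 0
  have hy1 : |((y 1 : ℤ) : ℝ) - x 1| ≤ 1 := by exact_mod_cast hy 1
  rw [abs_le] at hy0 hy1
  fin_cases i
  · have h0' := abs_le.1 (abs_ctr_sub_le (a := a) hδ (c + Pi.single 0 1) 0)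
    simp only [add_single_zero_apply_zero, Int.cast_add, Int.cast_one] at h0'
    have hx1 : ((x 1 : ℤ) : ℝ) = ctr a δ c 1 := by exact_mod_cast hxj 1 (by decide)
    simp only [Fin.zero_eta, box_zero, mem_hBox, meshPoint_re, meshPoint_im]
    rcases mem_uIcc.1 hxi with ⟨hr1, hr2⟩ | ⟨hr1, hr2⟩
    · have hr1' : ((ctr a δ c 0 : ℤ) : ℝ) ≤ x 0 := by exact_mod_cast hr1
      have hr2' : ((x 0 : ℤ) : ℝ) ≤ ctr a δ (c + Pi.single 0 1) 0 := by exact_mod_cast hr2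
      refine ⟨by nlinarith, by nlinarith, by nlinarith, by nlinarith⟩
    · have hr1' : ((ctr a δ (c + Pi.single 0 1) 0 : ℤ) : ℝ) ≤ x 0 := by exact_mod_cast hr1
      have hr2' : ((x 0 : ℤ) : ℝ) ≤ ctr a δ c 0 := by exact_mod_cast hr2
      refine ⟨by nlinarith, by nlinarith, by nlinarith, by nlinarith⟩
  · have h1' := abs_le.1 (abs_ctr_sub_le (a := a) hδ (c + Pi.single 1 1) 1)
    simp only [add_single_one_apply_one, Int.cast_add, Int.cast_one] at h1'
    have hx0 : ((x 0 : ℤ) : ℝ) = ctr a δ c 0 := by exact_mod_cast hxj 0 (by decide)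
    simp only [Fin.mk_one, box_one, mem_vBox, meshPoint_re, meshPoint_im]
    rcases mem_uIcc.1 hxi with ⟨hr1, hr2⟩ | ⟨hr1, hr2⟩
    · have hr1' : ((ctr a δ c 1 : ℤ) : ℝ) ≤ x 1 := by exact_mod_cast hr1
      have hr2' : ((x 1 : ℤ) : ℝ) ≤ ctr a δ (c + Pi.single 1 1) 1 := by exact_mod_cast hr2
      refine ⟨by nlinarith, by nlinarith, by nlinarith, by nlinarith⟩
    · have hr1' : ((ctr a δ (c + Pi.single 1 1) 1 : ℤ) : ℝ) ≤ x 1 := by exact_mod_cast hr1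
      have hr2' : ((x 1 : ℤ) : ℝ) ≤ ctr a δ c 1 := by exact_mod_cast hr2
      refine ⟨by nlinarith, by nlinarith, by nlinarith, by nlinarith⟩

/-- The centre fine sites of `c` and `c + eᵢ` agree in the other coordinate. [folklore] -/
theorem ctr_add_single_apply_of_ne (a δ : ℝ) (c : Site 2) {i j : Fin 2} (h : j ≠ i) :
    ctr a δ (c + Pi.single i 1) j = ctr a δ c j := by
  fin_cases i <;> fin_cases j <;> simp_all [ctr, nearestSite]

/-- The centre fine sites of two adjacent coarse cells of `S` are joined through interior sites
(`3δ < a`). [folklore] -/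
theorem intSites_reachable_ctr_ctr (hδ : 0 < δ) (h3 : 3 * δ < a) {c : Site 2} {i : Fin 2}
    (hc : c ∈ S) (hc' : c + Pi.single i 1 ∈ S) :
    ((zdGraph 2).induce (intSites S a δ)).Reachable ⟨ctr a δ c, ctr_mem_intSites hδ h3 hc⟩
      ⟨ctr a δ (c + Pi.single i 1), ctr_mem_intSites hδ h3 hc'⟩ := by
  set t := ctr a δ (c + Pi.single i 1) i with ht
  set R : Set (Site 2) := {x | x i ∈ uIcc (ctr a δ c i) t ∧ ∀ j, j ≠ i → x j = ctr a δ c j} with hR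
  have hbox : ∀ x ∈ R, ∀ y : Site 2, (∀ j, |y j - x j| ≤ 1) → meshPoint δ y ∈ meshPolygon S a :=
    fun x hx y hy => box_subset_meshPolygon hc hc' (meshPoint_mem_box_of_between hδ h3 hx.1 hx.2 hy)
  have hstep := induce_reachable_update (G := zdGraph 2) (T := intSites S a δ) (R := R) i t ?_
  · have hcR : ctr a δ c ∈ R := ⟨left_mem_uIcc, fun j _ => rfl⟩
    obtain ⟨hmem, hreach⟩ := hstep _ hcR (ctr_mem_intSites hδ h3 hc)
    have he : Function.update (ctr a δ c) i t = ctr a δ (c + Pi.single i 1) := by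
      ext j
      by_cases hj : j = i
      · subst hj; simp [ht]
      · rw [Function.update_of_ne hj, ctr_add_single_apply_of_ne a δ c hj]
    rw [he] at hmem hreach
    exact hreach _ _
  · rintro x ⟨hxi, hxj⟩ hxT hne
    have hσ := stepTowards_eq_or (x i) t
    set σ := stepTowards (x i) t with hσ_def
    set x' : Site 2 := x + Pi.single i σ with hx'
    have hx'i : x' i = x i + σ := by simp [hx']
    have hx'j : ∀ j, j ≠ i → x' j = x j := fun j hj => by simp [hx', hj]
    have hx'R : x' ∈ R := by
      refine ⟨?_, fun j hj => (hx'j j hj).trans (hxj j hj)⟩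
      rw [hx'i, hσ_def, stepTowards]
      rcases mem_uIcc.1 hxi with ⟨h1, h2⟩ | ⟨h1, h2⟩ <;> split_ifs with h <;>
        first | exact mem_uIcc.2 (Or.inl ⟨by omega, by omega⟩) | exact mem_uIcc.2 (Or.inr ⟨by omega, by omega⟩)
    have hx'T : x' ∈ intSites S a δ := by
      refine ⟨hbox x' hx'R x' fun j => by simp, fun y hy => hbox x' hx'R y fun j => ?_⟩
      obtain ⟨k, rfl | h⟩ := (zdGraph_adj_iff x' y).1 hy
      · rw [Pi.add_apply, Pi.single_apply]; split_ifs <;> simp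
      · rw [h, Pi.add_apply, Pi.single_apply]; split_ifs <;> simp
    refine ⟨x', hx'R, hx'T, zdGraph_adj_add_single x i hσ, ?_, ?_⟩
    · rw [hx'i]; exact natAbs_add_stepTowards_lt hne
    · ext j
      by_cases hj : j = i
      · subst hj; simp
      · rw [Function.update_of_ne hj, Function.update_of_ne hj, hx'j j hj]

/-- Chaining along a lattice path of `S` through interior sites. [folklore] -/
theorem intSites_reachable_ctr_of_reachable (hδ : 0 < δ) (h3 : 3 * δ < a) {c d : S}
    (h : ((zdGraph 2).induce S).Reachable c d) :
    ((zdGraph 2).induce (intSites S a δ)).Reachable ⟨ctr a δ c, ctr_mem_intSites hδ h3 c.2⟩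
      ⟨ctr a δ d, ctr_mem_intSites hδ h3 d.2⟩ := by
  rw [SimpleGraph.reachable_iff_reflTransGen] at h
  induction h with
  | refl => rfl
  | @tail b e _ hbe ih =>
    refine ih.trans ?_
    have hadj : (zdGraph 2).Adj (b : Site 2) e := SimpleGraph.comap_adj.1 hbe
    obtain ⟨i, he | hb⟩ := (zdGraph_adj_iff _ _).1 hadj
    · have he' : (b : Site 2) + Pi.single i 1 ∈ S := he ▸ e.2
      have := intSites_reachable_ctr_ctr (a := a) hδ h3 b.2 he'
      convert this using 3
    · have hb' : (e : Site 2) + Pi.single i 1 ∈ S := hb ▸ b.2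
      have := (intSites_reachable_ctr_ctr (a := a) hδ h3 e.2 hb').symm
      convert this using 3

/-- **The interior sites of a polyomino domain on a lattice-connected set of coarse cells are
lattice connected** (`3δ < a`). [folklore] -/
theorem intSites_preconnected (ha : 0 < a) (hδ : 0 < δ) (h3 : 3 * δ < a)
    (hS : ((zdGraph 2).induce S).Preconnected) : ((zdGraph 2).induce (intSites S a δ)).Preconnected := by
  rintro ⟨u, hu⟩ ⟨v, hv⟩
  have huc := mem_meshCell_nearestSite ha (meshPoint δ u)
  have hvc := mem_meshCell_nearestSite ha (meshPoint δ v)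
  have hcu : nearestSite a (meshPoint δ u) ∈ S := mem_of_mem_meshPolygon ha hu.1 huc
  have hcv : nearestSite a (meshPoint δ v) ∈ S := mem_of_mem_meshPolygon ha hv.1 hvc
  obtain ⟨_, hru⟩ := intSites_reachable_ctr ha hδ h3 huc hu
  obtain ⟨_, hrv⟩ := intSites_reachable_ctr ha hδ h3 hvc hv
  exact (hru.trans (intSites_reachable_ctr_of_reachable hδ h3 (c := ⟨_, hcu⟩) (d := ⟨_, hcv⟩)
    (hS _ _))).trans hrv.symm

/-! ### The complement of the interior sites is lattice connected -/

/-- The rectangle spanned by two points of a closed cell lies in the cell. [folklore] -/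
theorem rectangle_subset_meshCell {s : ℝ} {d : Site 2} {p q : ℂ} (hp : p ∈ meshCell s d) (hq : q ∈ meshCell s d) :
    Complex.Rectangle p q ⊆ meshCell s d := by
  intro z hz
  obtain ⟨hp0, hp1⟩ := mem_meshCell_iff.1 hp
  obtain ⟨hq0, hq1⟩ := mem_meshCell_iff.1 hq
  rw [abs_le] at hp0 hp1 hq0 hq1
  obtain ⟨hzre, hzim⟩ := hz
  refine mem_meshCell_iff.2 ⟨abs_le.2 ?_, abs_le.2 ?_⟩
  · rcases mem_uIcc.1 hzre with ⟨h1, h2⟩ | ⟨h1, h2⟩ <;> exact ⟨by linarith, by linarith⟩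
  · rcases mem_uIcc.1 hzim with ⟨h1, h2⟩ | ⟨h1, h2⟩ <;> exact ⟨by linarith, by linarith⟩

/-- **Two fine sites in one closed cell off `S` are joined through fine sites off the domain** (a
staircase inside the cell, which misses the domain). [folklore] -/
theorem induce_notMem_reachable_of_meshCell (ha : 0 < a) (hδ : 0 < δ) {d : Site 2} (hd : d ∉ S) {x y : Site 2}
    (hx : meshPoint δ x ∈ meshCell a d) (hy : meshPoint δ y ∈ meshCell a d) :
    ∃ (hx' : x ∈ {x | meshPoint δ x ∉ meshPolygon S a}) (hy' : y ∈ {x | meshPoint δ x ∉ meshPolygon S a}),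
      ((zdGraph 2).induce {x | meshPoint δ x ∉ meshPolygon S a}).Reachable ⟨x, hx'⟩ ⟨y, hy'⟩ := by
  have hdis := meshCell_disjoint_meshPolygon ha hd
  have hx' : meshPoint δ x ∉ meshPolygon S a := fun h => hdis.le_bot ⟨hx, h⟩
  have hy' : meshPoint δ y ∉ meshPolygon S a := fun h => hdis.le_bot ⟨hy, h⟩
  refine ⟨hx', hy', ?_⟩
  have h := meshVertexGraph_reachable_of_rectangle_subset (Ω := (meshPolygon S a)ᶜ) hδ _ x y rfl
    ((rectangle_subset_meshCell hx hy).trans (disjoint_left.1 hdis)) hx' hy'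
  exact h.mono (SimpleGraph.comap_monotone _ (meshGraph_le_zdGraph _ _))

/-- The centre fine site of a closed cell off `S` is off the domain. [folklore] -/
theorem meshPoint_ctr_mem_meshCell (hδ : 0 < δ) (h3 : 3 * δ < a) (d : Site 2) : meshPoint δ (ctr a δ d) ∈ meshCell a d :=
  openCell_subset_meshCell a d (meshPoint_ctr_mem_openCell hδ h3 d)

/-- **Two adjacent closed cells carry a bond of the fine lattice** (`δ ≤ a`): fine sites `u ∼ v` with
`δu` in the cell of `d` and `δv` in the cell of `d + eᵢ`. [folklore] -/
theorem exists_adj_meshCell_meshCell (hδ : 0 < δ) (hδa : δ ≤ a) (d : Site 2) (i : Fin 2) :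
    ∃ u v : Site 2, (zdGraph 2).Adj u v ∧ meshPoint δ u ∈ meshCell a d ∧ meshPoint δ v ∈ meshCell a (d + Pi.single i 1) := by
  set k : ℤ := ⌊(a * d i + a / 2) / δ⌋ with hk
  have hk1 : δ * k ≤ a * d i + a / 2 := by
    have := Int.floor_le ((a * d i + a / 2) / δ)
    rw [← hk] at this
    calc δ * k ≤ δ * ((a * d i + a / 2) / δ) := mul_le_mul_of_nonneg_left this hδ.le
      _ = a * d i + a / 2 := mul_div_cancel₀ _ hδ.ne'
  have hk2 : a * d i + a / 2 < δ * (k + 1) := by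
    have := Int.lt_floor_add_one ((a * d i + a / 2) / δ)
    rw [← hk] at this
    calc a * d i + a / 2 = δ * ((a * d i + a / 2) / δ) := (mul_div_cancel₀ _ hδ.ne').symm
      _ < δ * (k + 1) := mul_lt_mul_of_pos_left this hδ
  set u : Site 2 := Function.update (ctr a δ d) i k with hu
  refine ⟨u, u + Pi.single i 1, zdGraph_adj_add_single u i (Or.inl rfl), ?_, ?_⟩
  · have key : ∀ j, |δ * (u j : ℝ) - a * d j| ≤ a / 2 := by
      intro j
      by_cases hj : j = i
      · subst hj
        rw [hu, Function.update_self, abs_le]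
        constructor <;> nlinarith
      · rw [hu, Function.update_of_ne hj]
        exact (abs_ctr_sub_le hδ d j).trans (by linarith)
    rw [mem_meshCell_iff, meshPoint_re, meshPoint_im]
    exact ⟨key 0, key 1⟩
  · have key : ∀ j, |δ * ((u + Pi.single i 1 : Site 2) j : ℝ) - a * ((d + Pi.single i 1 : Site 2) j : ℝ)| ≤ a / 2 := by
      intro j
      by_cases hj : j = i
      · subst hj
        simp only [hu, Pi.add_apply, Pi.single_eq_same, Function.update_self, Int.cast_add, Int.cast_one]
        rw [abs_le]
        constructor <;> nlinarith
      · simp only [hu, Pi.add_apply, Pi.single_eq_of_ne hj, add_zero, Function.update_of_ne hj]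
        exact (abs_ctr_sub_le hδ d j).trans (by linarith)
    rw [mem_meshCell_iff, meshPoint_re, meshPoint_im]
    exact ⟨key 0, key 1⟩

/-- Chaining along a lattice path of `Sᶜ` through fine sites off the domain: the centre fine sites of
two lattice-connected closed cells off `S`. [folklore] -/
theorem induce_notMem_reachable_ctr_of_reachable (ha : 0 < a) (hδ : 0 < δ) (h3 : 3 * δ < a) {d d' : ↥Sᶜ}
    (h : ((zdGraph 2).induce Sᶜ).Reachable d d') :
    ∃ (h₁ : ctr a δ d ∈ {x | meshPoint δ x ∉ meshPolygon S a}) (h₂ : ctr a δ d' ∈ {x | meshPoint δ x ∉ meshPolygon S a}),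
      ((zdGraph 2).induce {x | meshPoint δ x ∉ meshPolygon S a}).Reachable ⟨ctr a δ d, h₁⟩ ⟨ctr a δ d', h₂⟩ := by
  have hδa : δ ≤ a := by linarith
  rw [SimpleGraph.reachable_iff_reflTransGen] at h
  induction h with
  | refl =>
    obtain ⟨h₁, h₂, hr⟩ := induce_notMem_reachable_of_meshCell ha hδ d.2 (meshPoint_ctr_mem_meshCell hδ h3 (d : Site 2))
      (meshPoint_ctr_mem_meshCell hδ h3 (d : Site 2))
    exact ⟨h₁, h₂, hr⟩
  | @tail b e _ hbe ih =>
    obtain ⟨h₁, hb₁, hr⟩ := ih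
    have hadj : (zdGraph 2).Adj (b : Site 2) e := SimpleGraph.comap_adj.1 hbe
    -- one step: centre of `b` → a bond across the common edge → centre of `e`
    have step : ∀ (p q : Site 2), p ∉ S → q ∉ S → (∃ i, q = p + Pi.single i 1) →
        ∃ (hp : ctr a δ p ∈ {x | meshPoint δ x ∉ meshPolygon S a}) (hq : ctr a δ q ∈ {x | meshPoint δ x ∉ meshPolygon S a}),
          ((zdGraph 2).induce {x | meshPoint δ x ∉ meshPolygon S a}).Reachable ⟨ctr a δ p, hp⟩ ⟨ctr a δ q, hq⟩ := by
      rintro p q hp hq ⟨i, rfl⟩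
      obtain ⟨u, v, huv, hu, hv⟩ := exists_adj_meshCell_meshCell hδ hδa p i
      obtain ⟨hp₁, hu₁, hr₁⟩ := induce_notMem_reachable_of_meshCell ha hδ hp (meshPoint_ctr_mem_meshCell hδ h3 p) hu
      obtain ⟨hv₁, hq₁, hr₂⟩ := induce_notMem_reachable_of_meshCell ha hδ hq hv (meshPoint_ctr_mem_meshCell hδ h3 _)
      have huv' : ((zdGraph 2).induce {x | meshPoint δ x ∉ meshPolygon S a}).Adj ⟨u, hu₁⟩ ⟨v, hv₁⟩ :=
        SimpleGraph.comap_adj.2 huv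
      exact ⟨hp₁, hq₁, (hr₁.trans huv'.reachable).trans hr₂⟩
    obtain ⟨i, he | hb⟩ := (zdGraph_adj_iff _ _).1 hadj
    · obtain ⟨_, he₁, hr'⟩ := step b e b.2 e.2 ⟨i, he⟩
      exact ⟨h₁, he₁, hr.trans hr'⟩
    · obtain ⟨_, _, hr'⟩ := step e b e.2 b.2 ⟨i, hb⟩
      exact ⟨h₁, _, hr.trans hr'.symm⟩

/-- **The fine sites off the domain are lattice connected when `Sᶜ` is** (`3δ < a`). [folklore] -/
theorem induce_notMem_preconnected (ha : 0 < a) (hδ : 0 < δ) (h3 : 3 * δ < a)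
    (hSc : ((zdGraph 2).induce Sᶜ).Preconnected) :
    ((zdGraph 2).induce {x | meshPoint δ x ∉ meshPolygon S a}).Preconnected := by
  rintro ⟨u, hu⟩ ⟨v, hv⟩
  obtain ⟨du, hdu, hudu⟩ := (not_mem_meshPolygon_iff ha).1 hu
  obtain ⟨dv, hdv, hvdv⟩ := (not_mem_meshPolygon_iff ha).1 hv
  obtain ⟨_, _, hru⟩ := induce_notMem_reachable_of_meshCell ha hδ hdu hudu (meshPoint_ctr_mem_meshCell hδ h3 du)
  obtain ⟨_, _, hrv⟩ := induce_notMem_reachable_of_meshCell ha hδ hdv hvdv (meshPoint_ctr_mem_meshCell hδ h3 dv)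
  obtain ⟨_, _, hr⟩ := induce_notMem_reachable_ctr_of_reachable ha hδ h3 (d := ⟨du, hdu⟩) (d' := ⟨dv, hdv⟩) (hSc _ _)
  exact (hru.trans hr).trans hrv.symm

/-- **The complement of the interior sites is lattice connected when `Sᶜ` is** (`3δ < a`): a
non-interior site is off the domain or adjacent to a site off the domain. [folklore] -/
theorem intSites_compl_preconnected (ha : 0 < a) (hδ : 0 < δ) (h3 : 3 * δ < a)
    (hSc : ((zdGraph 2).induce Sᶜ).Preconnected) : ((zdGraph 2).induce (intSites S a δ)ᶜ).Preconnected := by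
  set N : Set (Site 2) := {x | meshPoint δ x ∉ meshPolygon S a} with hN
  have hNI : N ≤ (intSites S a δ)ᶜ := fun x hx hI => hx hI.1
  set φ := SimpleGraph.induceHomOfLE (zdGraph 2) hNI with hφ
  -- every non-interior site is joined inside the complement to a site off the domain
  have key : ∀ x : ↥(intSites S a δ)ᶜ, ∃ n : N, ((zdGraph 2).induce (intSites S a δ)ᶜ).Reachable x (φ n) := by
    rintro ⟨x, hx⟩
    by_cases hxP : meshPoint δ x ∈ meshPolygon S a
    · have : ¬ ∀ y, (zdGraph 2).Adj x y → meshPoint δ y ∈ meshPolygon S a := fun h => hx ⟨hxP, h⟩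
      push Not at this
      obtain ⟨y, hxy, hy⟩ := this
      refine ⟨⟨y, hy⟩, SimpleGraph.Adj.reachable ?_⟩
      exact SimpleGraph.comap_adj.2 hxy
    · exact ⟨⟨x, hxP⟩, by rfl⟩
  intro x y
  obtain ⟨n, hn⟩ := key x
  obtain ⟨m, hm⟩ := key y
  exact (hn.trans ((induce_notMem_preconnected ha hδ h3 hSc n m).map φ.toHom)).trans hm.symm

/-- **The free sites of a polyomino domain are hole-free at fine meshes** (`3δ < a`, `S` finite and
lattice connected with lattice-connected complement): the hypothesis `HoleFree ↑(meshInteriorFinset Ω δ)`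
of `exists_kcCuts_primitive_mesh` (`IsingDisorderLaplacian.lean`) for the polyomino domains
`Ω = meshPolygon S a` — in particular for the inner and outer approximants of a Jordan domain
(`JordanPolyominoApproximants.lean`) — via `holeFree_of_induce_compl_preconnected`
(`MeshInteriorHoleFree.lean`). [folklore] -/
theorem holeFree_meshInteriorFinset_meshPolygon (ha : 0 < a) (hδ : 0 < δ) (h3 : 3 * δ < a) (hfin : S.Finite)
    (hS : ((zdGraph 2).induce S).Preconnected) (hSc : ((zdGraph 2).induce Sᶜ).Preconnected) :
    HoleFree (↑(meshInteriorFinset (meshPolygon S a) δ) : Set (Site 2)) := by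
  have heq : (↑(meshInteriorFinset (meshPolygon S a) δ) : Set (Site 2)) = intSites S a δ := by
    ext x
    rw [Finset.mem_coe, mem_meshInteriorFinset_meshPolygon_iff ha hδ h3 hfin hS, mem_intSites]
  have hfinI : (intSites S a δ).Finite := heq ▸ (meshInteriorFinset (meshPolygon S a) δ).finite_toSet
  rw [heq]
  exact holeFree_of_induce_compl_preconnected hfinI (intSites_compl_preconnected ha hδ h3 hSc)

end Interior

/-! ### CHI's approximation hypothesis `MeshApproximates` for polyomino domains -/

section Approx

variable {a δ : ℝ} {S : Set (Site 2)}

/-- The interior finset of a polyomino domain is the set `intSites` (`3δ < a`, `S` finite and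
lattice connected). [folklore] -/
theorem coe_meshInteriorFinset_eq (ha : 0 < a) (hδ : 0 < δ) (h3 : 3 * δ < a) (hfin : S.Finite)
    (hS : ((zdGraph 2).induce S).Preconnected) :
    (↑(meshInteriorFinset (meshPolygon S a) δ) : Set (Site 2)) = intSites S a δ := by
  ext x
  rw [Finset.mem_coe, mem_meshInteriorFinset_meshPolygon_iff ha hδ h3 hfin hS, mem_intSites]

/-- The polygonal domain `P_δ` of the free sites of a polyomino domain is the fine polyomino domain
of its interior sites. [folklore] -/
theorem meshInteriorPolygon_eq (ha : 0 < a) (hδ : 0 < δ) (h3 : 3 * δ < a) (hfin : S.Finite)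
    (hS : ((zdGraph 2).induce S).Preconnected) :
    meshInteriorPolygon (meshPolygon S a) δ = meshPolygon (intSites S a δ) δ := by
  rw [meshInteriorPolygon, coe_meshInteriorFinset_eq ha hδ h3 hfin hS]

/-- **`P_δ` is simply connected** for a polyomino domain (`3δ < a`; `S` finite, nonempty, lattice
connected with lattice-connected complement): it is itself an admissible (fine) polyomino domain.
[folklore] -/
theorem isSimplyConnected_meshInteriorPolygon (ha : 0 < a) (hδ : 0 < δ) (h3 : 3 * δ < a) (hfin : S.Finite)
    (hne : S.Nonempty) (hS : ((zdGraph 2).induce S).Preconnected) (hSc : ((zdGraph 2).induce Sᶜ).Preconnected) :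
    IsSimplyConnected (meshInteriorPolygon (meshPolygon S a) δ) := by
  rw [meshInteriorPolygon_eq ha hδ h3 hfin hS]
  exact (isAdmissibleDomain_meshPolygon hδ (intSites_finite hδ hfin) (intSites_nonempty hδ h3 hne)
    (intSites_preconnected ha hδ h3 hS) (intSites_compl_preconnected ha hδ h3 hSc)).2.2.2

/-- Adjacent fine sites have mesh points at distance `≤ δ` (in fact `= δ`). [folklore] -/
theorem dist_meshPoint_le_of_adj (hδ : 0 ≤ δ) {x y : Site 2} (h : (zdGraph 2).Adj x y) :
    dist (meshPoint δ x) (meshPoint δ y) ≤ δ := by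
  rw [Complex.dist_eq]
  refine (Complex.norm_le_abs_re_add_abs_im _).trans ?_
  rw [Complex.sub_re, Complex.sub_im, meshPoint_re, meshPoint_re, meshPoint_im, meshPoint_im]
  obtain ⟨k, rfl | rfl⟩ := (zdGraph_adj_iff x y).1 h <;> fin_cases k <;>
    simp [mul_add, abs_of_nonneg hδ]

/-- **Half of the Hausdorff estimate: the frontier of `P_δ` is within `2δ` of `∂P`.** A frontier
point of `P_δ` lies in the fine cell of an interior site (whose mesh point is in `P`) and in the fine
cell of a non-interior site (whose mesh point, or a neighbour's, is off `P`); the segment between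
these two points of `P` and `Pᶜ` carries a frontier point of `P`. [folklore] -/
theorem exists_frontier_near_of_mem_frontier_fine (ha : 0 < a) (hδ : 0 < δ) (h3 : 3 * δ < a) (hfin : S.Finite)
    (hS : ((zdGraph 2).induce S).Preconnected) {p : ℂ} (hp : p ∈ frontier (meshInteriorPolygon (meshPolygon S a) δ)) :
    ∃ f ∈ frontier (meshPolygon S a), dist p f ≤ 2 * δ := by
  rw [meshInteriorPolygon_eq ha hδ h3 hfin hS] at hp
  have hcl : p ∈ closure (meshPolygon (intSites S a δ) δ) := hp.1
  rw [closure_meshPolygon hδ] at hcl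
  obtain ⟨x, hxI, hpx⟩ := mem_iUnion₂.1 hcl
  obtain ⟨x', hx'I, hpx'⟩ := exists_of_mem_frontier_meshPolygon hδ hp
  have hdx : dist p (meshPoint δ x) ≤ δ := mem_closedBall.1 (meshCell_subset_closedBall x hpx)
  have hdx' : dist p (meshPoint δ x') ≤ δ := mem_closedBall.1 (meshCell_subset_closedBall x' hpx')
  -- a point off the coarse domain within `2δ` of `p`
  obtain ⟨u, huP, hu⟩ : ∃ u ∉ meshPolygon S a, dist p u ≤ 2 * δ := by
    by_cases hx'P : meshPoint δ x' ∈ meshPolygon S a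
    · have : ¬ ∀ y, (zdGraph 2).Adj x' y → meshPoint δ y ∈ meshPolygon S a := fun h => hx'I ⟨hx'P, h⟩
      push Not at this
      obtain ⟨y, hy, hyP⟩ := this
      refine ⟨_, hyP, ?_⟩
      calc dist p (meshPoint δ y) ≤ dist p (meshPoint δ x') + dist (meshPoint δ x') (meshPoint δ y) :=
            dist_triangle _ _ _
        _ ≤ δ + δ := add_le_add hdx' (dist_meshPoint_le_of_adj hδ.le hy)
        _ = 2 * δ := by ring
    · exact ⟨_, hx'P, hdx'.trans (by linarith)⟩
  obtain ⟨f, hfseg, hf⟩ := exists_mem_segment_mem_frontier (isOpen_meshPolygon S a) hxI.1 huP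
  refine ⟨f, hf, ?_⟩
  have h1 : meshPoint δ x ∈ closedBall p (2 * δ) := by rw [mem_closedBall, dist_comm]; linarith
  have h2 : u ∈ closedBall p (2 * δ) := by rw [mem_closedBall, dist_comm]; exact hu
  have := (convex_closedBall p (2 * δ)).segment_subset h1 h2 hfseg
  rwa [mem_closedBall, dist_comm] at this

/-- Clamping a real number to an interval moves it by at most the overshoot. [folklore] -/
theorem abs_clamp_sub_le {lo hi t r : ℝ} (h : lo ≤ hi) (hr : 0 ≤ r) (h1 : lo - r ≤ t) (h2 : t ≤ hi + r) :
    |max lo (min t hi) - t| ≤ r := by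
  rw [abs_le]
  rcases le_total t hi with hth | hth
  · rw [min_eq_left hth]
    rcases le_total lo t with hlt | hlt
    · rw [max_eq_right hlt]; constructor <;> linarith
    · rw [max_eq_left hlt]; constructor <;> linarith
  · rw [min_eq_right hth, max_eq_right h]; constructor <;> linarith

/-- **Deep fine sites near any point of a coarse cell** (`4δ ≤ a`): within distance `5δ` of any
point of the closed cell of `d` there is a fine site which, together with every fine site within
lattice distance one in each coordinate, has its mesh point in the OPEN cell of `d`. [folklore] -/
theorem exists_deep_site (hδ : 0 < δ) (h4 : 4 * δ ≤ a) {d : Site 2} {p : ℂ} (hp : p ∈ meshCell a d) :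
    ∃ y : Site 2, dist p (meshPoint δ y) ≤ 5 * δ ∧
      ∀ z : Site 2, (∀ j, |z j - y j| ≤ 1) → meshPoint δ z ∈ openCell a d := by
  obtain ⟨hp0, hp1⟩ := mem_meshCell_iff.1 hp
  rw [abs_le] at hp0 hp1
  have hlohi : ∀ m : ℤ, a * m - a / 2 + 2 * δ ≤ a * m + a / 2 - 2 * δ := fun m => by linarith
  set qre : ℝ := max (a * d 0 - a / 2 + 2 * δ) (min p.re (a * d 0 + a / 2 - 2 * δ)) with hqre
  set qim : ℝ := max (a * d 1 - a / 2 + 2 * δ) (min p.im (a * d 1 + a / 2 - 2 * δ)) with hqim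
  have hqre1 : |qre - p.re| ≤ 2 * δ := abs_clamp_sub_le (hlohi _) (by positivity) (by linarith) (by linarith)
  have hqim1 : |qim - p.im| ≤ 2 * δ := abs_clamp_sub_le (hlohi _) (by positivity) (by linarith) (by linarith)
  have hqre2 : a * d 0 - a / 2 + 2 * δ ≤ qre ∧ qre ≤ a * d 0 + a / 2 - 2 * δ :=
    ⟨le_max_left _ _, max_le (hlohi _) (min_le_right _ _)⟩
  have hqim2 : a * d 1 - a / 2 + 2 * δ ≤ qim ∧ qim ≤ a * d 1 + a / 2 - 2 * δ :=
    ⟨le_max_left _ _, max_le (hlohi _) (min_le_right _ _)⟩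
  set q : ℂ := ⟨qre, qim⟩ with hq
  set y := nearestSite δ q with hy
  obtain ⟨hy0, hy1⟩ := mem_meshCell_iff.1 (mem_meshCell_nearestSite hδ q)
  rw [← hy] at hy0 hy1
  simp only [hq] at hy0 hy1
  have e0 : |p.re - qre| ≤ 2 * δ := by rw [abs_sub_comm]; exact hqre1
  have e1 : |p.im - qim| ≤ 2 * δ := by rw [abs_sub_comm]; exact hqim1
  rw [abs_le] at hy0 hy1 hqre1 hqim1
  refine ⟨y, ?_, fun z hz => ?_⟩
  · calc dist p (meshPoint δ y) ≤ dist p q + dist q (meshPoint δ y) := dist_triangle _ _ _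
      _ ≤ 4 * δ + δ := by
          refine add_le_add ?_ ?_
          · rw [Complex.dist_eq]
            refine (Complex.norm_le_abs_re_add_abs_im _).trans ?_
            rw [Complex.sub_re, Complex.sub_im]
            simp only [hq]
            linarith
          · rw [Complex.dist_eq]
            refine (Complex.norm_le_abs_re_add_abs_im _).trans ?_
            rw [Complex.sub_re, Complex.sub_im, meshPoint_re, meshPoint_im]
            simp only [hq]
            have e0' : |qre - δ * (y 0 : ℝ)| ≤ δ / 2 := abs_le.2 hy0
            have e1' : |qim - δ * (y 1 : ℝ)| ≤ δ / 2 := abs_le.2 hy1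
            linarith
      _ = 5 * δ := by ring
  · have hz0 : |((z 0 : ℤ) : ℝ) - y 0| ≤ 1 := by exact_mod_cast hz 0
    have hz1 : |((z 1 : ℤ) : ℝ) - y 1| ≤ 1 := by exact_mod_cast hz 1
    rw [abs_le] at hz0 hz1
    rw [mem_openCell_iff, meshPoint_re, meshPoint_im, abs_lt, abs_lt]
    refine ⟨⟨by nlinarith, by nlinarith⟩, by nlinarith, by nlinarith⟩

/-- **Other half of the Hausdorff estimate: `∂P` is within `6δ` of the frontier of `P_δ`**
(`4δ ≤ a`). A point of `∂P` lies in a closed cell off `S`, so a deep fine site of that cell nearby is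
not interior and its mesh point is off `P_δ`; a nearby point of `P` has a deep fine site of an `S`-cell
nearby, which is interior with mesh point in `P_δ`; the segment between the two mesh points carries a
frontier point of `P_δ`. [folklore] -/
theorem exists_frontier_fine_near_of_mem_frontier (ha : 0 < a) (hδ : 0 < δ) (h4 : 4 * δ ≤ a) (hfin : S.Finite)
    (hS : ((zdGraph 2).induce S).Preconnected) {p : ℂ} (hp : p ∈ frontier (meshPolygon S a)) :
    ∃ f ∈ frontier (meshInteriorPolygon (meshPolygon S a) δ), dist p f ≤ 6 * δ := by
  have h3 : 3 * δ < a := by linarith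
  rw [meshInteriorPolygon_eq ha hδ h3 hfin hS]
  -- a fine mesh point off `P_δ` within `5δ`
  obtain ⟨d, hd, hpd⟩ := exists_of_mem_frontier_meshPolygon ha hp
  obtain ⟨y, hy, hydeep⟩ := exists_deep_site hδ h4 hpd
  have hyP : meshPoint δ y ∉ meshPolygon S a := fun h =>
    (meshCell_disjoint_meshPolygon ha hd).le_bot ⟨openCell_subset_meshCell a d (hydeep y fun j => by simp), h⟩
  have hyI : y ∉ intSites S a δ := fun h => hyP h.1
  have hyout : meshPoint δ y ∉ meshPolygon (intSites S a δ) δ := meshPoint_not_mem_meshPolygon hδ hyI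
  -- a fine mesh point in `P_δ` within `6δ`
  obtain ⟨v, hvP, hpv⟩ := Metric.mem_closure_iff.1 hp.1 δ hδ
  have hvc := mem_meshCell_nearestSite ha v
  have hc : nearestSite a v ∈ S := mem_of_mem_meshPolygon ha hvP hvc
  obtain ⟨x, hx, hxdeep⟩ := exists_deep_site hδ h4 hvc
  have hxI : x ∈ intSites S a δ := by
    refine ⟨openCell_subset_meshPolygon hc (hxdeep x fun j => by simp), fun z hz => openCell_subset_meshPolygon hc (hxdeep z fun j => ?_)⟩
    obtain ⟨i, h | h⟩ := (zdGraph_adj_iff x z).1 hz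
    · rw [h, Pi.add_apply, Pi.single_apply]; split_ifs <;> simp
    · rw [h, Pi.add_apply, Pi.single_apply]; split_ifs <;> simp
  have hxin : meshPoint δ x ∈ meshPolygon (intSites S a δ) δ := meshPoint_mem_meshPolygon hδ hxI
  obtain ⟨f, hfseg, hf⟩ := exists_mem_segment_mem_frontier (isOpen_meshPolygon _ δ) hxin hyout
  refine ⟨f, hf, ?_⟩
  have h1 : meshPoint δ x ∈ closedBall p (6 * δ) := by
    rw [mem_closedBall, dist_comm]
    calc dist p (meshPoint δ x) ≤ dist p v + dist v (meshPoint δ x) := dist_triangle _ _ _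
      _ ≤ δ + 5 * δ := add_le_add hpv.le hx
      _ = 6 * δ := by ring
  have h2 : meshPoint δ y ∈ closedBall p (6 * δ) := by rw [mem_closedBall, dist_comm]; linarith
  have := (convex_closedBall p (6 * δ)).segment_subset h1 h2 hfseg
  rwa [mem_closedBall, dist_comm] at this

/-- **Hausdorff estimate**: for `4δ ≤ a` the frontier of `P_δ` is within Hausdorff distance `6δ` of
`∂P`. [folklore] -/
theorem hausdorffDist_frontier_le (ha : 0 < a) (hδ : 0 < δ) (h4 : 4 * δ ≤ a) (hfin : S.Finite)
    (hS : ((zdGraph 2).induce S).Preconnected) :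
    hausdorffDist (frontier (meshInteriorPolygon (meshPolygon S a) δ)) (frontier (meshPolygon S a)) ≤ 6 * δ := by
  have h3 : 3 * δ < a := by linarith
  refine hausdorffDist_le_of_mem_dist (by positivity) (fun p hp => ?_) fun p hp =>
    exists_frontier_fine_near_of_mem_frontier ha hδ h4 hfin hS hp
  obtain ⟨f, hf, hd⟩ := exists_frontier_near_of_mem_frontier_fine ha hδ h3 hfin hS hp
  exact ⟨f, hf, hd.trans (by linarith)⟩

/-- **Compact exhaustion**: every compact subset of a polyomino domain lies in `P_δ` for all small
`δ`. [folklore] -/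
theorem eventually_subset_meshInteriorPolygon (ha : 0 < a) (hfin : S.Finite)
    (hS : ((zdGraph 2).induce S).Preconnected) {K : Set ℂ} (hK : IsCompact K) (hKP : K ⊆ meshPolygon S a) :
    ∀ᶠ δ in 𝓝[>] (0 : ℝ), K ⊆ meshInteriorPolygon (meshPolygon S a) δ := by
  obtain ⟨ε, hε, hεK⟩ := hK.exists_cthickening_subset_open (isOpen_meshPolygon S a) hKP
  filter_upwards [Ioo_mem_nhdsGT (show (0 : ℝ) < min (a / 4) (ε / 2) by positivity)] with δ hδ
  have hδ0 : 0 < δ := hδ.1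
  have hδa : δ < a / 4 := hδ.2.trans_le (min_le_left _ _)
  have hδε : δ < ε / 2 := hδ.2.trans_le (min_le_right _ _)
  rw [meshInteriorPolygon_eq ha hδ0 (by linarith) hfin hS]
  intro k hk
  refine mem_meshPolygon_of_forall hδ0 fun x hkx => ⟨?_, fun y hy => ?_⟩
  · refine hεK (mem_cthickening_of_dist_le _ k _ _ hk ?_)
    rw [dist_comm]
    exact (mem_closedBall.1 (meshCell_subset_closedBall x hkx)).trans (by linarith)
  · refine hεK (mem_cthickening_of_dist_le _ k _ _ hk ?_)
    calc dist (meshPoint δ y) k ≤ dist (meshPoint δ y) (meshPoint δ x) + dist (meshPoint δ x) k := dist_triangle _ _ _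
      _ ≤ δ + δ := add_le_add (by rw [dist_comm]; exact dist_meshPoint_le_of_adj hδ0.le hy)
          (by rw [dist_comm]; exact mem_closedBall.1 (meshCell_subset_closedBall x hkx))
      _ ≤ ε := by linarith

/-- **Polyomino domains satisfy CHI's approximation hypothesis `MeshApproximates`.** For `a > 0` and
a finite nonempty set of coarse sites `S`, lattice connected with lattice-connected complement, the
discretisations `(Ω_δ)` of the polyomino domain `Ω = meshPolygon S a` by the tree's fixed scheme
approximate `Ω` in the sense of Chelkak–Hongler–Izyurov (arXiv:1202.2838 §2.1 and §2.6: the polygonal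
domain of the free sites is eventually simply connected, its boundary tends to `∂Ω` in the Hausdorff
sense, and compacts are eventually swallowed). [cite: ChelkakHonglerIzyurovAnnals2015, §2.1 and §2.6 (Hausdorff approximation by discrete domains)] -/
theorem meshApproximates_meshPolygon (ha : 0 < a) (hfin : S.Finite) (hne : S.Nonempty)
    (hS : ((zdGraph 2).induce S).Preconnected) (hSc : ((zdGraph 2).induce Sᶜ).Preconnected) :
    MeshApproximates (meshPolygon S a) := by
  have h4pos : (0 : ℝ) < a / 4 := by positivity
  refine ⟨?_, ?_, fun K hK hKP => eventually_subset_meshInteriorPolygon ha hfin hS hK hKP⟩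
  · filter_upwards [Ioo_mem_nhdsGT h4pos] with δ hδ
    exact isSimplyConnected_meshInteriorPolygon ha hδ.1 (by linarith [hδ.2]) hfin hne hS hSc
  · have hup : Tendsto (fun δ : ℝ => 6 * δ) (𝓝[>] 0) (𝓝 0) := by
      have : Tendsto (fun δ : ℝ => 6 * δ) (𝓝 0) (𝓝 (6 * 0)) := (continuous_const.mul continuous_id).tendsto 0
      rw [mul_zero] at this
      exact tendsto_nhdsWithin_of_tendsto_nhds this
    refine tendsto_of_tendsto_of_tendsto_of_le_of_le' tendsto_const_nhds hup
      (Eventually.of_forall fun δ => hausdorffDist_nonneg) ?_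
    filter_upwards [Ioo_mem_nhdsGT h4pos] with δ hδ
    exact hausdorffDist_frontier_le ha hδ.1 (by linarith [hδ.2]) hfin hS

end Approx

end Polyomino

end Literature.Probability.LatticeModels
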